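/-
Copyright (c) 2026 the pub-hodgecm-mathlib formalisation cell (harness21).  Prover seat hodgecm-mathlib-F0P2-p01 (g17): road «S3-ram» (LEAD F0P3a-plan (g13);
(Cnt2′) chair F0P3a-p07 (g15) RULINGS (13)(5), (15); (α) block-law keeper F0P3a-p06 (g16)), organ «(K2-odd) THE REGIME-B ANISOTROPIC ROOT: ALL GRANDCHILDREN ARE `P ⊔ M`, ONE CLASS»
(road BLOCK for composition pen A-p16 (g33), 2026-09-02T04:58:50Z «GO»); 2026-09-02.
-/
import Literature.NumberTheory.Automorphic.UnitaryLatticeTreeAnisotropicRootEvenDepthLabels   -- ★ (K2-even) p849270∕p849286 (F0P3a-p04 (g20)): `pairing_endoShape_mulVec_endoShape`, `forall_endoGL_sub_one_mulVec_mem_scaleLattice_stdLattice`, `map_toLin'_le_scaleLattice_of_forall_mulVec_mem`; brings ★ (R1)–(R3) p849201 (F0P2-p01 (g16)), ★ FormTransport, ★ RegionGrandchildLabelsOfRoot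
import Literature.NumberTheory.Automorphic.UnitaryLatticeTreeBlockVertexShapeRamified         -- ★ ED. 3 p04 (g20): `residue_offDiag_eq_zero_and_diag_eq_of_unitary_diagonal_anisotropic_of_odd` (odd depth + small disc + anisotropy ⇒ residual W-operator SCALAR)
import Literature.NumberTheory.Automorphic.UnitaryLatticeTreeResidualTokens                -- ★ (F0P2-p06): `residue_ne_zero_of_v_eq_one`; brings ★ `exists_unit_v_sub_mul_sq_lt_one_iff_residue`, ★ `exists_ne_zero_eq_mul_sq_iff_quadraticChar`
import HarnessLib

/-!
# The lattice tree of the ramified `U(3)`: THE ANISOTROPIC ROOT AT ODD DEPTH IN REGIME B — every grandchild of the root is a `P^±` chain and ALL lie in ONE class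
# (Bruhat–Tits 1972 §10; Labesse–Langlands 1979 §2; Kottwitz 1986 §3; Rogawski 1990 §4.9)

Topic `NumberTheory/Automorphic`; namespace `Literature.NumberTheory.Automorphic.UnitaryLatticeTree`.  THEOREMS ONLY (no definition, no instance, no notation, no named fact,
no `sorry`); kernel lane `--supports stmt-HodgeConjecture-24833`; datum-free (`K` with `Valued K ℤᵐ⁰`, `σϖ = −ϖ`, `σ̄ = id`, `|2| = 1`).  Cell `pub/hodgecm-mathlib` (D-0151),
crux H413; road «S3-ram» (Literature seeding, count-neutral); (T2) G-side organ (Cnt2′) of the fold, the (α) block-law skeleton's ANISOTROPIC totals (composition pen A-p16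
(g33), ★ `…AnisotropicTotalsOdd` ∕ `…AnisotropicTotalsPm`), branch **regime B** (root depth `d₀ = m` ODD, `3 ≤ m < N`: the `u`-line and the TRACELESS part of the block are deeper
than the SCALAR part; ★ `typeTwo_depthDictionary_{even,odd}_ram` clause `|2u_w − tr g_w| = |ϖ^m|`): the census atoms `(NE, NP, NM)` of ★ `strataCount_J₀_of_charpoly_block_raw_singleton`
(p848877) at the anisotropic literal are **`(0, #GC(r₀), 0)` or `(0, 0, #GC(r₀))`** according to ONE residue-class atom — «all `(q+1)q` root grandchildren are `P`-chains of the
same class» (B-p14 (g40) MEMO v2 (L2); chair RULING (15): «aniso root chains ∈ CLS(c) ⟺ ¬Λ(c)»; A-p16 (g33) OPEN SEAM 04:40:27Z, road BLOCK).  The EVEN-depth twin (regime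
A-even, all grandchildren `O`) is ★ `UnitaryLatticeTreeAnisotropicRootEvenDepthLabels` (F0P3a-p04 (g20)).

THE MECHANISM.  Block model `H = ι(diag d, η)` anisotropic (`hanis`), `Γ = ι(γ₁, u)`, root `L₀ = 𝒪³` of level `D` (ODD) for `Γ − 1`, `T := ϖ^{−D}(γ₁ − 1)` integral, line
part `|u₀₀ − 1| < |ϖ|^D`, scalar part EXACT `|tr γ₁ − 2u₀₀| = |ϖ|^D`, traceless part DEEPER `|tr² − 4det| < |ϖ|^{2D}` (regime B):
* (§1) at ODD depth the first-order unitarity relation is `ᵗT̄·D̄ − D̄·T̄ = 0` (`σ(ϖ^D) = −ϖ^D`): `D̄T̄` is SYMMETRIC; with `(T̄₀₀ − T̄₁₁)² + 4T̄₀₁T̄₁₀ = 0` (small discriminant)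
  and the residual ANISOTROPY of `diag d̄` this forces `T̄ = b̄·1` SCALAR (★ p04 (g20) ED. 3 `residue_offDiag_eq_zero_and_diag_eq_of_unitary_diagonal_anisotropic_of_odd`,
  here in valuation currency `v_offDiag_lt_one_and_v_diag_sub_lt_one_of_unitary_diagonal_odd`), `b̄ ≠ 0`; hence the residual
  value is `ϖ^{−D}⟨z,(Γ−1)z⟩ ≡ b̄·⟨z̄_W, z̄_W⟩` on `𝒪³` (`v_inv_pow_mul_pairing_diagonal_sub_lt_one`), and on a residually ISOTROPIC non-axial `z̄` (the child through which a
  grandchild hangs, ★ (R1)) `⟨z̄_W,z̄_W⟩ = −η̄ z̄₁²`, so **`−val ≡ b̄·η̄·z̄₁² ≠ 0`** (`v_inv_pow_mul_pairing_endoShape_add_lt_one`);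
* (§2) by ★ (R2) `LEV_w(ϖ^{D−1}) ⟺ |val| < 1` every root grandchild has `¬LEV(ϖ^{D−1})` (hence `¬LEV(ϖ^D)`), `LEV(ϖ^{D−2})` (★ (R2)), and by ★ (R3) its depth-`(D−2)` class
  token for the unit `c₀` holds iff `b·η ∈ c₀·(𝒪^×)²` residually, `b := (tr γ₁ − 2u₀₀)∕(2ϖ^D)` — the SAME for all grandchildren: **`anisotropicRoot_tokens_of_odd_regimeB`**
  (block model, SET currency, map form);
* (§3) the `Φ₃`∕`J₀`-MODEL CENSUS for `γ = P·ι(γ₁,u)·P⁻¹ ∈ U(σ,J₀) ∩ K₀` (★ p849270 §4 transport pattern: ★ `isSelfDualLattice_formCongr_iff`, ★ `map_conj_sub_one_le_scaleLattice_iff`,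
  ★ `exists_mem_mapGL_class_iff`, ★ `mapGL_conj_mapGL_eq_iff`): **`anisotropicRoot_odd_census_of_coe_eq_conj_endoGL`** — in ★ p848877's `hNE hNP hNM` set-builder texts
  VERBATIM: `#E = 0`, and `(Λη → #P = #GC(r₀) ∧ #M = 0) ∧ (¬Λη → #P = 0 ∧ #M = #GC(r₀))` with `Λη := ∃ a, |a| = 1 ∧ |b·η − c₁a²| < 1`;
* (§4) the chair's orientation `Λ(c) := ∃ a, |a| = 1 ∧ |b − c a²| < 1` (RULING (15)): for a residual NON-SQUARE `η` (`hηN`, the anisotropic line value) `Λη ⟺ ¬Λ`, so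
  **`anisotropicRoot_odd_census_of_coe_eq_conj_endoGL_of_nonsquare`**: `(Λ → #P = 0 ∧ #M = #GC) ∧ (¬Λ → #P = #GC ∧ #M = 0)` — «aniso root chains ∈ CLS(c) ⟺ ¬Λ(c)».
HONEST LABEL: HC_CM is proved only modulo the 2 remaining named inputs (hLiu418 24832, h413 24833) until rung 0 closes; nothing printed is asserted here (valuation algebra and
lattice bookkeeping over ★ results); «S3-ram» has no books consequence.

## References
* [BruhatTits1972] F. Bruhat, J. Tits, *Groupes réductifs sur un corps local I*, Publ. Math. IHÉS 41 (1972), §10 (lattice models; vertex stabilisers).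
* [LabesseLanglands1979] J.-P. Labesse, R. P. Langlands, *L-indistinguishability for SL(2)*, Canad. J. Math. 31 (1979), §2 (the rank-2 block at the two classes).
* [Kottwitz1986] R. E. Kottwitz, *Base change for unit elements of Hecke algebras*, Compositio Math. 60 (1986), §3 (levels of fixed lattices, shell by shell).
* [Rogawski1990] J. D. Rogawski, *Automorphic Representations of Unitary Groups in Three Variables*, Ann. of Math. Stud. 123 (1990), §4.8 Case (a) p. 53, §4.9 Prop. 4.9.1 (b)
  p. 55, Lemma 4.9.3 p. 56 (the strata of the ramified orbital integrals).
* [IrelandRosen1990] K. Ireland, M. Rosen, *A Classical Introduction to Modern Number Theory*, GTM 84 (1990), Ch. 8 §1 (the quadratic character of a finite field).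
-/

set_option autoImplicit false

noncomputable section

open scoped Valued WithZero Matrix MatrixGroups
open Literature.NumberTheory.Automorphic Literature.NumberTheory.Automorphic.HermitianLattice Literature.NumberTheory.Automorphic.UnitaryLatticeTree
open Literature.NumberTheory.Rogawski1990 Literature.NumberTheory.Automorphic.UnitaryGroup

namespace Literature.NumberTheory.Automorphic.UnitaryLatticeTree

variable {K : Type*} [Field K] [Valued K ℤᵐ⁰] {σ : K →+* K} {ϖ : K}

/-! ## §1 Odd depth, regime B: the residual W-operator is a non-zero SCALAR, and the residual value on an isotropic child line -/

/-- **ODD-DEPTH UNITARITY + SMALL DISCRIMINANT + ANISOTROPY ⇒ THE RESIDUAL W-OPERATOR IS SCALAR** (valuation currency of ★ F0P3a-p04 (g20) ED. 3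
`residue_offDiag_eq_zero_and_diag_eq_of_unitary_diagonal_anisotropic_of_odd`): for `g ∈ U(σ, diag d)` (`diag d̄` anisotropic) at ODD depth `D`, `|g − 1| ≤ |ϖ|^D`, with
`|tr(g)² − 4det(g)| < |ϖ|^{2D}` (regime B: the traceless part is deeper), writing `T = ϖ^{−D}(g − 1)`: `|T₀₁| < 1`, `|T₁₀| < 1`, `|T₀₀ − T₁₁| < 1` (`diag(d̄)·T̄` is SYMMETRIC since
`σ(ϖ^D) = −ϖ^D`, `(T̄₀₀ − T̄₁₁)² + 4T̄₀₁T̄₁₀ = 0`, and `d̄₀ + d̄₁X²` has no root). [cite: LabesseLanglands1979, §2] [cite: Kottwitz1986, §3] [cite: Rogawski1990, §4.9 Lemma 4.9.3 p. 56] -/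
theorem v_offDiag_lt_one_and_v_diag_sub_lt_one_of_unitary_diagonal_odd (hvσ : ∀ a, Valued.v (σ a) = Valued.v a) (hσϖ : σ ϖ = -ϖ)
    (hϖ : Valued.v ϖ = WithZero.exp (-1 : ℤ)) (hres : ∀ x : K, Valued.v x ≤ 1 → Valued.v (σ x - x) < 1) (h2 : Valued.v (2 : K) = 1)
    {d : Fin 2 → K} (hd : ∀ i, Valued.v (d i) = 1)
    (hanis₀ : ∀ c : K, Valued.v c ≤ 1 → Valued.v (d 0 + d 1 * (σ c * c)) = 1)
    (g : Matrix (Fin 2) (Fin 2) K) (hg : (g.map σ)ᵀ * Matrix.diagonal d * g = Matrix.diagonal d)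
    {D : ℕ} (hD : Odd D) (hdeep : ∀ i j, Valued.v ((g - 1) i j) ≤ Valued.v ϖ ^ D)
    (hdiscB : Valued.v (g.trace ^ 2 - 4 * g.det) < Valued.v ϖ ^ (2 * D)) :
    Valued.v ((ϖ ^ D)⁻¹ * (g - 1) 0 1) < 1 ∧ Valued.v ((ϖ ^ D)⁻¹ * (g - 1) 1 0) < 1 ∧
      Valued.v ((ϖ ^ D)⁻¹ * (g - 1) 0 0 - (ϖ ^ D)⁻¹ * (g - 1) 1 1) < 1 := by
  have hϖ0 : ϖ ≠ 0 := fun h0 => by rw [h0, map_zero] at hϖ; exact WithZero.coe_ne_zero hϖ.symm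
  have hϖD0 : (ϖ ^ D : K) ≠ 0 := pow_ne_zero _ hϖ0
  have hvD : Valued.v ((ϖ ^ D)⁻¹ : K) * Valued.v ϖ ^ D = 1 := by rw [← map_pow, ← map_mul, inv_mul_cancel₀ hϖD0, map_one]
  have hTint : ∀ i j, Valued.v ((ϖ ^ D)⁻¹ * (g - 1) i j) ≤ 1 := fun i j => by
    rw [map_mul]
    calc Valued.v ((ϖ ^ D)⁻¹ : K) * Valued.v ((g - 1) i j) ≤ Valued.v ((ϖ ^ D)⁻¹ : K) * Valued.v ϖ ^ D := by gcongr; exact hdeep i j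
      _ = 1 := hvD
  set T : Matrix (Fin 2) (Fin 2) 𝒪[K] := fun i j => ⟨(ϖ ^ D)⁻¹ * (g - 1) i j, (Valuation.mem_integer_iff _ _).2 (hTint i j)⟩ with hTdef
  obtain ⟨h01, h10, hdg⟩ := residue_offDiag_eq_zero_and_diag_eq_of_unitary_diagonal_anisotropic_of_odd hvσ hσϖ hϖ hres h2 hd hanis₀ g hg hD T
    (fun _ _ => rfl) hdiscB
  rw [residue_eq_zero_iff_v_lt_one] at h01 h10
  rw [← sub_eq_zero, ← map_sub, residue_eq_zero_iff_v_lt_one, AddSubgroupClass.coe_sub] at hdg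
  exact ⟨h01, h10, hdg⟩

/-- **THE RESIDUAL VALUE OF A RESIDUALLY SCALAR BLOCK** (rank `2`, diagonal form): if `T = ϖ^{−D}(g − 1)` has `|T₀₁|, |T₁₀|, |T₀₀ − T₁₁| < 1` then
`|ϖ^{−D}⟨y,(g−1)y⟩_{diag d} − T₀₀·⟨y,y⟩_{diag d}| < 1` for every integral `y` (the difference is `d₀σ(y₀)y₁T₀₁ + d₁σ(y₁)y₀T₁₀ − d₁σ(y₁)y₁(T₀₀ − T₁₁)`).
[cite: Kottwitz1986, §3] [cite: Rogawski1990, §4.9 p. 55] -/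
theorem v_inv_pow_mul_pairing_diagonal_sub_lt_one (hvσ : ∀ a, Valued.v (σ a) = Valued.v a) (hϖ : Valued.v ϖ = WithZero.exp (-1 : ℤ))
    {d : Fin 2 → K} (hd : ∀ i, Valued.v (d i) = 1)
    (g : Matrix (Fin 2) (Fin 2) K) {D : ℕ}
    (hoff₀₁ : Valued.v ((ϖ ^ D)⁻¹ * (g - 1) 0 1) < 1) (hoff₁₀ : Valued.v ((ϖ ^ D)⁻¹ * (g - 1) 1 0) < 1)
    (hdiag : Valued.v ((ϖ ^ D)⁻¹ * (g - 1) 0 0 - (ϖ ^ D)⁻¹ * (g - 1) 1 1) < 1)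
    (y : Fin 2 → K) (hy : ∀ i, Valued.v (y i) ≤ 1) :
    Valued.v ((ϖ ^ D)⁻¹ * pairing σ (Matrix.diagonal d) y ((g - 1) *ᵥ y) - (ϖ ^ D)⁻¹ * (g - 1) 0 0 * pairing σ (Matrix.diagonal d) y y) < 1 := by
  have hϖ0 : ϖ ≠ 0 := fun h0 => by rw [h0, map_zero] at hϖ; exact WithZero.coe_ne_zero hϖ.symm
  have hϖD0 : (ϖ ^ D : K) ≠ 0 := pow_ne_zero _ hϖ0
  set T : Fin 2 → Fin 2 → K := fun i j => (ϖ ^ D)⁻¹ * (g - 1) i j with hTdef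
  have hsub : ∀ i j, (g - 1) i j = ϖ ^ D * T i j := fun i j => by simp only [hTdef, mul_inv_cancel_left₀ hϖD0]
  have hyσ : ∀ i, Valued.v (σ (y i)) ≤ 1 := fun i => by rw [hvσ]; exact hy i
  have hval : (ϖ ^ D)⁻¹ * pairing σ (Matrix.diagonal d) y ((g - 1) *ᵥ y) - (ϖ ^ D)⁻¹ * (g - 1) 0 0 * pairing σ (Matrix.diagonal d) y y =
      d 0 * σ (y 0) * y 1 * T 0 1 + d 1 * σ (y 1) * y 0 * T 1 0 - d 1 * σ (y 1) * y 1 * (T 0 0 - T 1 1) := by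
    have h00 : (ϖ ^ D)⁻¹ * (g - 1) 0 0 = T 0 0 := rfl
    rw [h00]
    simp only [pairing_apply, Fin.sum_univ_two, Matrix.mulVec, dotProduct, Matrix.diagonal_apply_eq,
      Matrix.diagonal_apply_ne _ (show (0 : Fin 2) ≠ 1 by decide), Matrix.diagonal_apply_ne _ (show (1 : Fin 2) ≠ 0 by decide), hsub,
      mul_zero, zero_mul, add_zero, zero_add]
    field_simp
    ring
  rw [hval]
  have t1 : Valued.v (d 0 * σ (y 0) * y 1 * T 0 1) < 1 := by
    rw [map_mul, mul_comm]
    refine mul_lt_one_of_lt_of_le hoff₀₁ ?_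
    rw [map_mul, map_mul, hd 0, one_mul]; exact mul_le_one' (hyσ 0) (hy 1)
  have t2 : Valued.v (d 1 * σ (y 1) * y 0 * T 1 0) < 1 := by
    rw [map_mul, mul_comm]
    refine mul_lt_one_of_lt_of_le hoff₁₀ ?_
    rw [map_mul, map_mul, hd 1, one_mul]; exact mul_le_one' (hyσ 1) (hy 0)
  have t3 : Valued.v (d 1 * σ (y 1) * y 1 * (T 0 0 - T 1 1)) < 1 := by
    rw [map_mul, mul_comm]
    refine mul_lt_one_of_lt_of_le hdiag ?_
    rw [map_mul, map_mul, hd 1, one_mul]; exact mul_le_one' (hyσ 1) (hy 1)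
  exact (Valued.v.map_sub _ _).trans_lt (max_lt ((Valued.v.map_add _ _).trans_lt (max_lt t1 t2)) t3)

/-- **THE RESIDUAL VALUE OF `ι(g,u) − 1` ON A RESIDUALLY ISOTROPIC VECTOR** (block form `H = ι(diag d, η)`): if the W-block of `T = ϖ^{−D}(Γ − 1)` is residually the scalar
`T₀₀` (§1 hypotheses), the line part is deeper (`|u₀₀ − 1| < |ϖ|^D`), and `z ∈ 𝒪³` is residually isotropic (`|⟨z,z⟩_H| < 1`, so `⟨z_W,z_W⟩_{diag d} ≡ −σ(z₁)ηz₁`), then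
**`ϖ^{−D}⟨z,(Γ−1)z⟩_H ≡ −T₀₀·η·σ(z₁)z₁`**: `|ϖ^{−D}⟨z,(Γ−1)z⟩_H + T₀₀·η·σ(z₁)z₁| < 1`. [cite: Kottwitz1986, §3] [cite: Rogawski1990, §4.9 p. 55] -/
theorem v_inv_pow_mul_pairing_endoShape_add_lt_one (hvσ : ∀ a, Valued.v (σ a) = Valued.v a) (hϖ : Valued.v ϖ = WithZero.exp (-1 : ℤ))
    {d : Fin 2 → K} (hd : ∀ i, Valued.v (d i) = 1) {η : K} (hη : Valued.v η ≤ 1)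
    (g : GL (Fin 2) K) (u : GL (Fin 1) K) {D : ℕ}
    (hdeep : ∀ i j, Valued.v (((g : Matrix (Fin 2) (Fin 2) K) - 1) i j) ≤ Valued.v ϖ ^ D)
    (hoff₀₁ : Valued.v ((ϖ ^ D)⁻¹ * ((g : Matrix (Fin 2) (Fin 2) K) - 1) 0 1) < 1) (hoff₁₀ : Valued.v ((ϖ ^ D)⁻¹ * ((g : Matrix (Fin 2) (Fin 2) K) - 1) 1 0) < 1)
    (hdiag : Valued.v ((ϖ ^ D)⁻¹ * ((g : Matrix (Fin 2) (Fin 2) K) - 1) 0 0 - (ϖ ^ D)⁻¹ * ((g : Matrix (Fin 2) (Fin 2) K) - 1) 1 1) < 1)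
    (hu : Valued.v ((u : Matrix (Fin 1) (Fin 1) K) 0 0 - 1) < Valued.v ϖ ^ D)
    (z : Fin 3 → K) (hz : ∀ i, Valued.v (z i) ≤ 1)
    (hiso : Valued.v (pairing σ (!![(Matrix.diagonal d) 0 0, 0, (Matrix.diagonal d) 0 1; 0, η, 0; (Matrix.diagonal d) 1 0, 0, (Matrix.diagonal d) 1 1] : Matrix (Fin 3) (Fin 3) K) z z) < 1) :
    Valued.v ((ϖ ^ D)⁻¹ * pairing σ (!![(Matrix.diagonal d) 0 0, 0, (Matrix.diagonal d) 0 1; 0, η, 0; (Matrix.diagonal d) 1 0, 0, (Matrix.diagonal d) 1 1] : Matrix (Fin 3) (Fin 3) K) z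
        ((((endoGL (g, u) : GL (Fin 3) K) : Matrix (Fin 3) (Fin 3) K) - 1) *ᵥ z) +
      (ϖ ^ D)⁻¹ * ((g : Matrix (Fin 2) (Fin 2) K) - 1) 0 0 * η * (σ (z 1) * z 1)) < 1 := by
  have hϖ0 : ϖ ≠ 0 := fun h0 => by rw [h0, map_zero] at hϖ; exact WithZero.coe_ne_zero hϖ.symm
  have hϖD0 : (ϖ ^ D : K) ≠ 0 := pow_ne_zero _ hϖ0
  have hpos : 0 < Valued.v ϖ ^ D := by rw [← map_pow]; exact zero_lt_iff.2 ((Valuation.ne_zero_iff _).2 hϖD0)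
  have hvD : Valued.v ((ϖ ^ D)⁻¹ : K) * Valued.v ϖ ^ D = 1 := by rw [← map_pow, ← map_mul, inv_mul_cancel₀ hϖD0, map_one]
  have hT00 : Valued.v ((ϖ ^ D)⁻¹ * ((g : Matrix (Fin 2) (Fin 2) K) - 1) 0 0) ≤ 1 := by
    rw [map_mul]
    calc Valued.v ((ϖ ^ D)⁻¹ : K) * Valued.v (((g : Matrix (Fin 2) (Fin 2) K) - 1) 0 0) ≤ Valued.v ((ϖ ^ D)⁻¹ : K) * Valued.v ϖ ^ D := by gcongr; exact hdeep 0 0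
      _ = 1 := hvD
  have hu' : Valued.v ((ϖ ^ D)⁻¹ * ((u : Matrix (Fin 1) (Fin 1) K) 0 0 - 1)) < 1 := by
    rw [map_mul, map_inv₀, map_pow]
    calc (Valued.v ϖ ^ D)⁻¹ * Valued.v ((u : Matrix (Fin 1) (Fin 1) K) 0 0 - 1) < (Valued.v ϖ ^ D)⁻¹ * Valued.v ϖ ^ D := by
          exact mul_lt_mul_of_pos_left hu (inv_pos.2 hpos)
      _ = 1 := inv_mul_cancel₀ hpos.ne'
  have hzσ : ∀ i, Valued.v (σ (z i)) ≤ 1 := fun i => by rw [hvσ]; exact hz i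
  -- block decomposition of the value and of the norm
  have hzz : pairing σ (!![(Matrix.diagonal d) 0 0, 0, (Matrix.diagonal d) 0 1; 0, η, 0; (Matrix.diagonal d) 1 0, 0, (Matrix.diagonal d) 1 1] : Matrix (Fin 3) (Fin 3) K) z z =
      pairing σ (Matrix.diagonal d) ![z 0, z 2] ![z 0, z 2] + σ (z 1) * η * z 1 := by
    simp only [pairing_apply, Fin.sum_univ_three, Fin.sum_univ_two, Matrix.diagonal_apply_eq,
      Matrix.diagonal_apply_ne _ (show (0 : Fin 2) ≠ 1 by decide), Matrix.diagonal_apply_ne _ (show (1 : Fin 2) ≠ 0 by decide),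
      Matrix.of_apply, Matrix.cons_val', Matrix.cons_val_zero, Matrix.cons_val_one, Matrix.cons_val_two, Matrix.empty_val', Matrix.cons_val_fin_one,
      Matrix.head_cons, Matrix.tail_cons, Matrix.head_fin_const]
    ring
  have hW := v_inv_pow_mul_pairing_diagonal_sub_lt_one hvσ hϖ hd (g : Matrix (Fin 2) (Fin 2) K) hoff₀₁ hoff₁₀ hdiag ![z 0, z 2]
    (fun i => by fin_cases i <;> simp [hz])
  rw [coe_endoGL_sub_one_eq_endoShape, pairing_endoShape_mulVec_endoShape]
  have e : (ϖ ^ D)⁻¹ * (pairing σ (Matrix.diagonal d) ![z 0, z 2] ((((g : Matrix (Fin 2) (Fin 2) K) - 1)) *ᵥ ![z 0, z 2]) +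
        σ (z 1) * η * (((u : Matrix (Fin 1) (Fin 1) K) 0 0 - 1) * z 1)) + (ϖ ^ D)⁻¹ * ((g : Matrix (Fin 2) (Fin 2) K) - 1) 0 0 * η * (σ (z 1) * z 1) =
      ((ϖ ^ D)⁻¹ * pairing σ (Matrix.diagonal d) ![z 0, z 2] ((((g : Matrix (Fin 2) (Fin 2) K) - 1)) *ᵥ ![z 0, z 2]) -
          (ϖ ^ D)⁻¹ * ((g : Matrix (Fin 2) (Fin 2) K) - 1) 0 0 * pairing σ (Matrix.diagonal d) ![z 0, z 2] ![z 0, z 2]) +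
        (ϖ ^ D)⁻¹ * ((g : Matrix (Fin 2) (Fin 2) K) - 1) 0 0 * (pairing σ (Matrix.diagonal d) ![z 0, z 2] ![z 0, z 2] + σ (z 1) * η * z 1) +
        σ (z 1) * η * z 1 * ((ϖ ^ D)⁻¹ * ((u : Matrix (Fin 1) (Fin 1) K) 0 0 - 1)) := by ring
  rw [e]
  refine (Valued.v.map_add _ _).trans_lt (max_lt ((Valued.v.map_add _ _).trans_lt (max_lt hW ?_)) ?_)
  · rw [← hzz, map_mul, mul_comm]
    exact mul_lt_one_of_lt_of_le hiso hT00
  · rw [map_mul, mul_comm]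
    refine mul_lt_one_of_lt_of_le hu' ?_
    rw [map_mul, map_mul, hvσ]
    exact mul_le_one' (mul_le_one' (hz 1) hη) (hz 1)

/-- **CLASS BOOKKEEPING**: if `t ≡ −X·σ(z)z` residually (`|t + X·σ(z)z| < 1`) with `z` a unit and `X` integral, then for every integral `c`: «`t + c·a² ≡ 0` for some unit `a`»
iff «`X ≡ c·a² ` for some unit `a`» (`a ↦ a∕z`, `σ(z) ≡ z`). [cite: Rogawski1990, §4.9 p. 55] [cite: IrelandRosen1990, Ch. 8 §1] -/
theorem exists_unit_v_add_mul_sq_lt_one_iff_of_v_add_mul_norm_lt_one (hvσ : ∀ a, Valued.v (σ a) = Valued.v a)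
    (hres : ∀ x : K, Valued.v x ≤ 1 → Valued.v (σ x - x) < 1)
    {t X z c : K} (hX : Valued.v X ≤ 1) (hz : Valued.v z = 1) (h : Valued.v (t + X * (σ z * z)) < 1) :
    (∃ a : K, Valued.v a = 1 ∧ Valued.v (t + c * a ^ 2) < 1) ↔ ∃ a : K, Valued.v a = 1 ∧ Valued.v (X - c * a ^ 2) < 1 := by
  have _h := hvσ
  have hz0 : z ≠ 0 := fun h0 => by rw [h0, map_zero] at hz; exact zero_ne_one hz
  have hXz : Valued.v (X * z * (σ z - z)) < 1 := by
    rw [map_mul, map_mul, hz, mul_one, mul_comm]; exact mul_lt_one_of_lt_of_le (hres z hz.le) hX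
  constructor
  · rintro ⟨a, ha, hlt⟩
    refine ⟨a / z, by rw [map_div₀, ha, hz, div_one], ?_⟩
    have e : X - c * (a / z) ^ 2 = (z ^ 2)⁻¹ * ((t + X * (σ z * z)) - (t + c * a ^ 2) - X * z * (σ z - z)) := by field_simp; ring
    rw [e, map_mul, map_inv₀, map_pow, hz, one_pow, inv_one, one_mul]
    exact (Valued.v.map_sub _ _).trans_lt (max_lt ((Valued.v.map_sub _ _).trans_lt (max_lt h hlt)) hXz)
  · rintro ⟨a, ha, hlt⟩
    refine ⟨a * z, by rw [map_mul, ha, hz, one_mul], ?_⟩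
    have e : t + c * (a * z) ^ 2 = (t + X * (σ z * z)) - X * z * (σ z - z) - z ^ 2 * (X - c * a ^ 2) := by ring
    rw [e]
    refine (Valued.v.map_sub _ _).trans_lt (max_lt ((Valued.v.map_sub _ _).trans_lt (max_lt h hXz)) ?_)
    rw [map_mul, map_pow, hz, one_pow, one_mul]; exact hlt

/-- Residually equal class representatives give the same class token: `|X − X′| < 1 ⇒ (∃ a unit, |X − ca²| < 1) ↔ (∃ a unit, |X′ − ca²| < 1)`. [cite: IrelandRosen1990, Ch. 8 §1] -/
theorem exists_unit_v_sub_mul_sq_lt_one_congr {X X' c : K} (h : Valued.v (X - X') < 1) :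
    (∃ a : K, Valued.v a = 1 ∧ Valued.v (X - c * a ^ 2) < 1) ↔ ∃ a : K, Valued.v a = 1 ∧ Valued.v (X' - c * a ^ 2) < 1 := by
  refine exists_congr fun a => and_congr_right fun _ => ?_
  have e : X - c * a ^ 2 - (X' - c * a ^ 2) = X - X' := by ring
  constructor
  · intro hx
    have h' : Valued.v (X' - c * a ^ 2 - (X - c * a ^ 2)) < 1 := by rw [← Valuation.map_neg, neg_sub, e]; exact h
    have := Valuation.map_add_lt Valued.v hx h'
    rwa [add_sub_cancel] at this
  · intro hx'
    have h' : Valued.v (X - c * a ^ 2 - (X' - c * a ^ 2)) < 1 := by rw [e]; exact h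
    have := Valuation.map_add_lt Valued.v hx' h'
    rwa [add_sub_cancel] at this

/-! ## §2 Assembly in the block model (set currency): the tokens of every self-dual lattice two steps from the root -/

set_option maxHeartbeats 800000 in
-- budget only: statement-heavy block tokens.
/-- **(§2) THE TOKENS OF EVERY ROOT GRANDCHILD OF THE ANISOTROPIC LITERAL IN REGIME B (block model, set currency).**  `H = ι(diag d, η)` anisotropic, `Γ = ι(γ₁, u)`,
`γ₁ ∈ U(σ, diag d)`, ODD `D ≥ 3` with `|γ₁ − 1| ≤ |ϖ|^D`, line part `|u₀₀ − 1| < |ϖ|^D`, scalar part EXACT `|tr γ₁ − 2u₀₀| = |ϖ|^D` and traceless part DEEPER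
`|tr² − 4det| < |ϖ|^{2D}` (regime B, root depth `m = D < N`).  Then EVERY self-dual lattice `w ≠ L₀` with `ϖL₀ ≤ w`, `ϖw ≤ L₀` (the root's grandchildren, ★ (R1); all of
them are `Γ`-stable, ★ (R2)) satisfies, in map form: **`¬LEV_w(ϖ^D)`**, **`¬LEV_w(ϖ^{D−1})`** (the collar value is a UNIT, §1 + ★ (R2)), **`LEV_w(ϖ^{D−2})`** (★ (R2)), and its
depth-`(D−2)` CLASS token for ANY unit `c₀` (★ (R3) `anisotropicRoot_class_iff`, the `∃ y ∈ w, ∃ a, …` text of ★ p848877's `hNP`) holds **iff `b·η ≡ c₀·a²` for some unit `a`**,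
`b := (tr γ₁ − 2u₀₀)∕(2ϖ^D)` — a condition INDEPENDENT of `w`: all `(q+1)q` grandchildren carry the token `P^±` of ONE class (none is `E`).
[cite: Kottwitz1986, §3] [cite: BruhatTits1972, §10] [cite: LabesseLanglands1979, §2] [cite: Rogawski1990, §4.9 Prop. 4.9.1 (b) p. 55, Lemma 4.9.3 p. 56] -/
theorem anisotropicRoot_tokens_of_odd_regimeB [IsPrincipalIdealRing 𝒪[K]] (σ : K →+* K) (hσ : ∀ a, σ (σ a) = a) (hvσ : ∀ a, Valued.v (σ a) = Valued.v a)
    {ϖ : K} (hσϖ : σ ϖ = -ϖ) (hϖ : Valued.v ϖ = WithZero.exp (-1 : ℤ)) (hres : ∀ x : K, Valued.v x ≤ 1 → Valued.v (σ x - x) < 1) (h2 : Valued.v (2 : K) = 1)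
    {d : Fin 2 → K} (hd : ∀ i, Valued.v (d i) = 1) (hdσ : ∀ i, σ (d i) = d i)
    (hanis₀ : ∀ c : K, Valued.v c ≤ 1 → Valued.v (d 0 + d 1 * (σ c * c)) = 1)
    (hanis₁ : ∀ c : K, Valued.v c ≤ 1 → Valued.v (d 0 * (σ c * c) + d 1) = 1)
    {η : K} (hη : Valued.v η = 1) (hησ : σ η = η)
    (γ₁ : GL (Fin 2) K) (u : GL (Fin 1) K) (hγU : γ₁ ∈ unitaryGroupOfForm σ (Matrix.diagonal d))
    {D : ℕ} (hD : Odd D) (hD3 : 3 ≤ D)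
    (hdeep : ∀ i j, Valued.v (((γ₁ : Matrix (Fin 2) (Fin 2) K) - 1) i j) ≤ Valued.v ϖ ^ D)
    (hu : Valued.v ((u : Matrix (Fin 1) (Fin 1) K) 0 0 - 1) < Valued.v ϖ ^ D)
    (htr : Valued.v ((γ₁ : Matrix (Fin 2) (Fin 2) K).trace - 2 * (u : Matrix (Fin 1) (Fin 1) K) 0 0) = Valued.v ϖ ^ D)
    (hdiscB : Valued.v ((γ₁ : Matrix (Fin 2) (Fin 2) K).trace ^ 2 - 4 * (γ₁ : Matrix (Fin 2) (Fin 2) K).det) < Valued.v ϖ ^ (2 * D))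
    {w : Submodule 𝒪[K] (Fin 3 → K)} (hw : IsSelfDualLattice σ ϖ (!![(Matrix.diagonal d) 0 0, 0, (Matrix.diagonal d) 0 1; 0, η, 0; (Matrix.diagonal d) 1 0, 0, (Matrix.diagonal d) 1 1] : Matrix (Fin 3) (Fin 3) K) w)
    (hLw : scaleLattice (ϖ ^ 1) (stdLattice K 3) ≤ w) (hwL : scaleLattice (ϖ ^ 1) w ≤ stdLattice K 3) (hne : w ≠ stdLattice K 3)
    {c₀ : K} (hc₀ : Valued.v c₀ = 1) :
    ¬ w.map ((Matrix.toLin' (((endoGL (γ₁, u) : GL (Fin 3) K) : Matrix (Fin 3) (Fin 3) K) - 1)).restrictScalars 𝒪[K]) ≤ scaleLattice (ϖ ^ D) w ∧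
    ¬ w.map ((Matrix.toLin' (((endoGL (γ₁, u) : GL (Fin 3) K) : Matrix (Fin 3) (Fin 3) K) - 1)).restrictScalars 𝒪[K]) ≤ scaleLattice (ϖ ^ (D - 1)) w ∧
    w.map ((Matrix.toLin' (((endoGL (γ₁, u) : GL (Fin 3) K) : Matrix (Fin 3) (Fin 3) K) - 1)).restrictScalars 𝒪[K]) ≤ scaleLattice (ϖ ^ (D - 2)) w ∧
    ((∃ y ∈ w, ∃ a : K, Valued.v a = 1 ∧ Valued.v ((ϖ ^ (D - 2))⁻¹ * pairing σ (!![(Matrix.diagonal d) 0 0, 0, (Matrix.diagonal d) 0 1; 0, η, 0; (Matrix.diagonal d) 1 0, 0, (Matrix.diagonal d) 1 1] : Matrix (Fin 3) (Fin 3) K) y ((((endoGL (γ₁, u) : GL (Fin 3) K) : Matrix (Fin 3) (Fin 3) K) - 1) *ᵥ y) - c₀ * a ^ 2) < 1) ↔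
      ∃ a : K, Valued.v a = 1 ∧ Valued.v (((γ₁ : Matrix (Fin 2) (Fin 2) K).trace - 2 * (u : Matrix (Fin 1) (Fin 1) K) 0 0) / (2 * ϖ ^ D) * η - c₀ * a ^ 2) < 1) := by
  have hϖ0 : ϖ ≠ 0 := fun h0 => by rw [h0, map_zero] at hϖ; exact WithZero.coe_ne_zero hϖ.symm
  have hϖD0 : (ϖ ^ D : K) ≠ 0 := pow_ne_zero _ hϖ0
  have hϖ1 : Valued.v ϖ < 1 := by rw [hϖ, ← WithZero.exp_zero]; exact WithZero.exp_lt_exp.2 (by norm_num)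
  have hpos : 0 < Valued.v ϖ ^ D := by rw [← map_pow]; exact zero_lt_iff.2 ((Valuation.ne_zero_iff _).2 hϖD0)
  have hvD : Valued.v ((ϖ ^ D)⁻¹ : K) * Valued.v ϖ ^ D = 1 := by rw [← map_pow, ← map_mul, inv_mul_cancel₀ hϖD0, map_one]
  have h20 : (2 : K) ≠ 0 := fun h0 => by rw [h0, map_zero] at h2; exact zero_ne_one h2
  have hD2 : 2 ≤ D := by omega
  -- the root has level `D`
  have hlev := forall_endoGL_sub_one_mulVec_mem_scaleLattice_stdLattice hϖ γ₁ u hdeep hu.le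
  -- §1: the residual W-operator is the scalar `T₀₀`
  obtain ⟨hoff₀₁, hoff₁₀, hdiag⟩ := v_offDiag_lt_one_and_v_diag_sub_lt_one_of_unitary_diagonal_odd hvσ hσϖ hϖ hres h2 hd hanis₀
    (γ₁ : Matrix (Fin 2) (Fin 2) K) hγU hD hdeep hdiscB
  -- ★ (R1)∕(R2): the collar generator, the child line `z = ϖx₀`, fixedness and the level tokens
  obtain ⟨_, x₀, hx₀, hx₀1, hzint, hz1, hziso, _, _, _⟩ :=
    exists_generator_of_anisotropicRoot_sandwich σ hσ hvσ hϖ hd hdσ hanis₀ hanis₁ hη hησ hw hLw hwL hne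
  obtain ⟨_, hlev2, hlev1⟩ := anisotropicRoot_fixed_and_lev_iff σ hσ hvσ hϖ hd hdσ hanis₀ hanis₁ hη hησ γ₁ u hD2 hlev hw hLw hwL hne hx₀ hx₀1
  have hz : ∀ i, Valued.v ((ϖ • x₀) i) ≤ 1 := fun i => (mem_stdLattice.1 hzint) i
  have hiso : Valued.v (pairing σ (!![(Matrix.diagonal d) 0 0, 0, (Matrix.diagonal d) 0 1; 0, η, 0; (Matrix.diagonal d) 1 0, 0, (Matrix.diagonal d) 1 1] : Matrix (Fin 3) (Fin 3) K) (ϖ • x₀) (ϖ • x₀)) < 1 :=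
    hziso.trans_lt (by rw [← map_pow, map_pow]; exact pow_lt_one₀ zero_le hϖ1 two_ne_zero)
  -- §1: `val ≡ −T₀₀·η·σ(z₁)z₁`
  have key := v_inv_pow_mul_pairing_endoShape_add_lt_one hvσ hϖ hd hη.le γ₁ u hdeep hoff₀₁ hoff₁₀ hdiag hu (ϖ • x₀) hz hiso
  -- the scalar residue `b = (tr γ₁ − 2u₀₀)∕(2ϖ^D)` is a unit and `≡ T₀₀`
  set b : K := ((γ₁ : Matrix (Fin 2) (Fin 2) K).trace - 2 * (u : Matrix (Fin 1) (Fin 1) K) 0 0) / (2 * ϖ ^ D) with hb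
  have hbv : Valued.v b = 1 := by
    rw [hb, map_div₀, htr, map_mul, h2, one_mul, map_pow, div_self hpos.ne']
  have hbT : Valued.v (b - (ϖ ^ D)⁻¹ * ((γ₁ : Matrix (Fin 2) (Fin 2) K) - 1) 0 0) < 1 := by
    have e : b - (ϖ ^ D)⁻¹ * ((γ₁ : Matrix (Fin 2) (Fin 2) K) - 1) 0 0 =
        -((2 : K)⁻¹ * ((ϖ ^ D)⁻¹ * ((γ₁ : Matrix (Fin 2) (Fin 2) K) - 1) 0 0 - (ϖ ^ D)⁻¹ * ((γ₁ : Matrix (Fin 2) (Fin 2) K) - 1) 1 1)) -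
          (ϖ ^ D)⁻¹ * ((u : Matrix (Fin 1) (Fin 1) K) 0 0 - 1) := by
      rw [hb, Matrix.trace_fin_two, Matrix.sub_apply, Matrix.sub_apply, Matrix.one_apply_eq, Matrix.one_apply_eq]
      field_simp
      ring
    rw [e]
    refine (Valued.v.map_sub _ _).trans_lt (max_lt ?_ ?_)
    · rw [Valuation.map_neg, map_mul, map_inv₀, h2, inv_one, one_mul]; exact hdiag
    · rw [map_mul, map_inv₀, map_pow]
      calc (Valued.v ϖ ^ D)⁻¹ * Valued.v ((u : Matrix (Fin 1) (Fin 1) K) 0 0 - 1) < (Valued.v ϖ ^ D)⁻¹ * Valued.v ϖ ^ D :=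
            mul_lt_mul_of_pos_left hu (inv_pos.2 hpos)
        _ = 1 := inv_mul_cancel₀ hpos.ne'
  have hT00 : Valued.v ((ϖ ^ D)⁻¹ * ((γ₁ : Matrix (Fin 2) (Fin 2) K) - 1) 0 0) = 1 := by
    have e : (ϖ ^ D)⁻¹ * ((γ₁ : Matrix (Fin 2) (Fin 2) K) - 1) 0 0 = b - (b - (ϖ ^ D)⁻¹ * ((γ₁ : Matrix (Fin 2) (Fin 2) K) - 1) 0 0) := by ring
    rw [e, Valuation.map_sub_eq_of_lt_left _ (by rw [hbv]; exact hbT), hbv]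
  -- the collar value is a UNIT
  have hX : Valued.v ((ϖ ^ D)⁻¹ * ((γ₁ : Matrix (Fin 2) (Fin 2) K) - 1) 0 0 * η * (σ ((ϖ • x₀) 1) * (ϖ • x₀) 1)) = 1 := by
    simp only [map_mul, hT00, hη, hvσ, hz1, one_mul]
  have hunit : Valued.v ((ϖ ^ D)⁻¹ * pairing σ (!![(Matrix.diagonal d) 0 0, 0, (Matrix.diagonal d) 0 1; 0, η, 0; (Matrix.diagonal d) 1 0, 0, (Matrix.diagonal d) 1 1] : Matrix (Fin 3) (Fin 3) K) (ϖ • x₀)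
      ((((endoGL (γ₁, u) : GL (Fin 3) K) : Matrix (Fin 3) (Fin 3) K) - 1) *ᵥ (ϖ • x₀))) = 1 := by
    have e : (ϖ ^ D)⁻¹ * pairing σ (!![(Matrix.diagonal d) 0 0, 0, (Matrix.diagonal d) 0 1; 0, η, 0; (Matrix.diagonal d) 1 0, 0, (Matrix.diagonal d) 1 1] : Matrix (Fin 3) (Fin 3) K) (ϖ • x₀)
        ((((endoGL (γ₁, u) : GL (Fin 3) K) : Matrix (Fin 3) (Fin 3) K) - 1) *ᵥ (ϖ • x₀)) =
      ((ϖ ^ D)⁻¹ * pairing σ (!![(Matrix.diagonal d) 0 0, 0, (Matrix.diagonal d) 0 1; 0, η, 0; (Matrix.diagonal d) 1 0, 0, (Matrix.diagonal d) 1 1] : Matrix (Fin 3) (Fin 3) K) (ϖ • x₀)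
        ((((endoGL (γ₁, u) : GL (Fin 3) K) : Matrix (Fin 3) (Fin 3) K) - 1) *ᵥ (ϖ • x₀)) +
        (ϖ ^ D)⁻¹ * ((γ₁ : Matrix (Fin 2) (Fin 2) K) - 1) 0 0 * η * (σ ((ϖ • x₀) 1) * (ϖ • x₀) 1)) -
        (ϖ ^ D)⁻¹ * ((γ₁ : Matrix (Fin 2) (Fin 2) K) - 1) 0 0 * η * (σ ((ϖ • x₀) 1) * (ϖ • x₀) 1) := by ring
    rw [e, Valuation.map_sub_eq_of_lt_right _ (by rw [hX]; exact key), hX]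
  have hnot1 : ¬ w.map ((Matrix.toLin' (((endoGL (γ₁, u) : GL (Fin 3) K) : Matrix (Fin 3) (Fin 3) K) - 1)).restrictScalars 𝒪[K]) ≤ scaleLattice (ϖ ^ (D - 1)) w := by
    intro hle
    have hlt := hlev1.1 (forall_mulVec_mem_scaleLattice_of_map_le _ _ _ hle)
    rw [hunit] at hlt
    exact lt_irrefl _ hlt
  refine ⟨fun hle => hnot1 (hle.trans (scaleLattice_pow_le_of_le hϖ1.le w (Nat.sub_le D 1))), hnot1,
    map_toLin'_le_scaleLattice_of_forall_mulVec_mem _ _ _ hlev2, ?_⟩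
  -- the class token: ★ (R3), then `val ≡ −T₀₀ησ(z₁)z₁`, then `T₀₀ ≡ b`
  rw [anisotropicRoot_class_iff σ hσ hvσ hϖ hd hdσ hanis₀ hanis₁ hη hησ hres hσϖ γ₁ u hD2 hlev hw hLw hwL hne hx₀ hx₀1 hunit hc₀,
    exists_unit_v_add_mul_sq_lt_one_iff_of_v_add_mul_norm_lt_one hvσ hres (c := c₀)
      (by rw [map_mul, hT00, hη, one_mul]) hz1 key]
  refine exists_unit_v_sub_mul_sq_lt_one_congr ?_
  have e : (ϖ ^ D)⁻¹ * ((γ₁ : Matrix (Fin 2) (Fin 2) K) - 1) 0 0 * η - b * η = -(η * (b - (ϖ ^ D)⁻¹ * ((γ₁ : Matrix (Fin 2) (Fin 2) K) - 1) 0 0)) := by ring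
  rw [e, Valuation.map_neg, map_mul, hη, one_mul]
  exact hbT

/-! ## §3 The `Φ₃`∕`J₀`-model census of the anisotropic literal `P·ι(γ₁,u)·P⁻¹` in regime B: `NE = 0`, and `(NP, NM) = (#GC, 0)` or `(0, #GC)` by ONE class atom -/

set_option maxHeartbeats 1600000 in
-- budget only: statement-heavy lattice tokens (the ★ odd head's set-builders verbatim).
/-- **(§3) THE REGIME-B ANISOTROPIC ROOT CENSUS in ★ `strataCount_J₀_of_charpoly_block_raw_singleton`'s own currency.**  For `γ = P·ι(γ₁,u)·P⁻¹ ∈ U(σ, J₀) ∩ K₀` with the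
frame `ᵗσ(P)J₀P = ι(diag d, η)` (anisotropic unit data), `P·L₀ = L₀`, and the block data of §2 (`γ₁ ∈ U(σ, diag d)`, ODD `d₀ ≥ 3`, `|γ₁ − 1| ≤ |ϖ|^{d₀}`, `|u₀₀ − 1| < |ϖ|^{d₀}`,
scalar part exact `|tr γ₁ − 2u₀₀| = |ϖ|^{d₀}`, traceless part deeper `|tr²−4det| < |ϖ|^{2d₀}`): among the `γ`-fixed grandchildren of the root `r₀` — the ★ head's set `GC(r₀)` —
the `E`-token set is EMPTY, and for the unit class constant `c₁` the `P`-token set is ALL of `GC(r₀)` and the `M`-token set EMPTY when **`Λη(c₁) := ∃ a, |a| = 1 ∧ |b·η − c₁a²| < 1`**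
(`b = (tr γ₁ − 2u₀₀)∕(2ϖ^{d₀})`) holds, and the other way round when it fails; stated as `ncard` identities feeding `hNE hNP hNM` (set-builders CHARACTER-EQUAL to ★ p848877's; the
grandchild set `GC(r₀)` in ★ p849286 §5's spelling, `#GC(r₀) = (q+1)q` there).  Transport `J₀ ↔ ι(diag d, η)` along `M ↦ P⁻¹M` as in ★ p849270 §4 (`isSelfDualLattice_formCongr_iff`,
`map_conj_sub_one_le_scaleLattice_iff`, `exists_mem_mapGL_class_iff`, `mapGL_conj_mapGL_eq_iff`); self-duality and the sandwich of a grandchild from the `J₀`-graph.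
[cite: Kottwitz1986, §3] [cite: BruhatTits1972, §10] [cite: LabesseLanglands1979, §2] [cite: Rogawski1990, §4.9 Prop. 4.9.1 (b) p. 55, Lemma 4.9.3 p. 56] -/
theorem anisotropicRoot_odd_census_of_coe_eq_conj_endoGL [IsPrincipalIdealRing 𝒪[K]]
    (hσ : ∀ a, σ (σ a) = a) (hvσ : ∀ a, Valued.v (σ a) = Valued.v a) (hσϖ : σ ϖ = -ϖ) (hϖ : Valued.v ϖ = WithZero.exp (-1 : ℤ))
    (hres : ∀ x : K, Valued.v x ≤ 1 → Valued.v (σ x - x) < 1) (h2 : Valued.v (2 : K) = 1)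
    {d : Fin 2 → K} {η : K} (P : GL (Fin 3) K)
    (hP : formCongr σ P ((StdForm.antidiagonal 3).over K) = (!![(Matrix.diagonal d) 0 0, 0, (Matrix.diagonal d) 0 1; 0, η, 0; (Matrix.diagonal d) 1 0, 0, (Matrix.diagonal d) 1 1] : Matrix (Fin 3) (Fin 3) K))
    (hP0 : mapGL P (stdLattice K 3) = stdLattice K 3)
    (hd : ∀ i, Valued.v (d i) = 1) (hdσ : ∀ i, σ (d i) = d i)
    (hanis₀ : ∀ c : K, Valued.v c ≤ 1 → Valued.v (d 0 + d 1 * (σ c * c)) = 1)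
    (hanis₁ : ∀ c : K, Valued.v c ≤ 1 → Valued.v (d 0 * (σ c * c) + d 1) = 1)
    (hησ : σ η = η) (hη : Valued.v η = 1)
    (γ : unitaryGroupOfForm σ ((StdForm.antidiagonal 3).over K))
    (γ₁ : GL (Fin 2) K) (u : GL (Fin 1) K) (hγ : (γ : GL (Fin 3) K) = P * endoGL (γ₁, u) * P⁻¹)
    (hγU : γ₁ ∈ unitaryGroupOfForm σ (Matrix.diagonal d))
    {d₀ : ℕ} (hD : Odd d₀) (hD3 : 3 ≤ d₀)
    (hdeep : ∀ i j, Valued.v (((γ₁ : Matrix (Fin 2) (Fin 2) K) - 1) i j) ≤ Valued.v ϖ ^ d₀)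
    (hu : Valued.v ((u : Matrix (Fin 1) (Fin 1) K) 0 0 - 1) < Valued.v ϖ ^ d₀)
    (htr : Valued.v ((γ₁ : Matrix (Fin 2) (Fin 2) K).trace - 2 * (u : Matrix (Fin 1) (Fin 1) K) 0 0) = Valued.v ϖ ^ d₀)
    (hdiscB : Valued.v ((γ₁ : Matrix (Fin 2) (Fin 2) K).trace ^ 2 - 4 * (γ₁ : Matrix (Fin 2) (Fin 2) K).det) < Valued.v ϖ ^ (2 * d₀)) (c₁ : K) (hc₁ : Valued.v c₁ = 1) :
    ({w | w ∈ {w | ∃ c, ((latticeGraph σ ϖ ((StdForm.antidiagonal 3).over K)).Adj (⟨stdLattice K 3, 0, isSelfDualLattice_stdLattice_three_of_v hϖ⟩ : {M : Submodule 𝒪[K] (Fin 3 → K) // IsVertex σ ϖ ((StdForm.antidiagonal 3).over K) M}) c ∧ (latticeGraph σ ϖ ((StdForm.antidiagonal 3).over K)).dist ⟨stdLattice K 3, 0, isSelfDualLattice_stdLattice_three_of_v hϖ⟩ c = (latticeGraph σ ϖ ((StdForm.antidiagonal 3).over K)).dist ⟨stdLattice K 3, 0, isSelfDualLattice_stdLattice_three_of_v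 hϖ⟩ (⟨stdLattice K 3, 0, isSelfDualLattice_stdLattice_three_of_v hϖ⟩ : {M : Submodule 𝒪[K] (Fin 3 → K) // IsVertex σ ϖ ((StdForm.antidiagonal 3).over K) M}) + 1 ∧ latticeGraphIso σ ϖ ((StdForm.antidiagonal 3).over K) γ c = c) ∧ ((latticeGraph σ ϖ ((StdForm.antidiagonal 3).over K)).Adj c w ∧ (latticeGraph σ ϖ ((StdForm.antidiagonal 3).over K)).dist ⟨stdLattice K 3, 0, isSelfDualLattice_stdLattice_three_of_v hϖ⟩ w = (latticeGraph σ ϖ ((StdForm.antidiagonal 3).over K)).dist ⟨stdLattice K 3, 0, isSelfDualLattice_stdLattice_three_of_v hϖ⟩ c + 1 ∧ latticeGraphIso σ ϖ ((StdForm.antidiagonal 3).over K) γ w = w)} ∧ (¬ w.1.map ((Matrix.toLin' (((γ : GL (Fin 3) K) : Matrix (Fin 3) (Fin 3) K) - 1)).restrictScalars 𝒪[K]) ≤ scaleLattice (ϖ ^ d₀) w.1 ∧ (w.1.map ((Matrix.toLin' (((γ : GL (Fin 3) K) : Matrix (Fin 3) (Fin 3) K) - 1)).restrictScalars 𝒪[K])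 ≤ scaleLattice (ϖ ^ (d₀ - 1)) w.1 ∧ ¬ w.1.map ((Matrix.toLin' (((γ : GL (Fin 3) K) : Matrix (Fin 3) (Fin 3) K) - 1)).restrictScalars 𝒪[K]) ≤ scaleLattice (ϖ ^ d₀) w.1))}).ncard = 0 ∧
    ((∃ a : K, Valued.v a = 1 ∧ Valued.v (((γ₁ : Matrix (Fin 2) (Fin 2) K).trace - 2 * (u : Matrix (Fin 1) (Fin 1) K) 0 0) / (2 * ϖ ^ d₀) * η - c₁ * a ^ 2) < 1) →
      ({w | w ∈ {w | ∃ c, ((latticeGraph σ ϖ ((StdForm.antidiagonal 3).over K)).Adj (⟨stdLattice K 3, 0, isSelfDualLattice_stdLattice_three_of_v hϖ⟩ : {M : Submodule 𝒪[K] (Fin 3 → K) // IsVertex σ ϖ ((StdForm.antidiagonal 3).over K) M}) c ∧ (latticeGraph σ ϖ ((StdForm.antidiagonal 3).over K)).dist ⟨stdLattice K 3, 0, isSelfDualLattice_stdLattice_three_of_v hϖ⟩ c = (latticeGraph σ ϖ ((StdForm.antidiagonal 3).over K)).dist ⟨stdLattice K 3, 0, isSelfDualLattice_stdLattice_three_of_v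 hϖ⟩ (⟨stdLattice K 3, 0, isSelfDualLattice_stdLattice_three_of_v hϖ⟩ : {M : Submodule 𝒪[K] (Fin 3 → K) // IsVertex σ ϖ ((StdForm.antidiagonal 3).over K) M}) + 1 ∧ latticeGraphIso σ ϖ ((StdForm.antidiagonal 3).over K) γ c = c) ∧ ((latticeGraph σ ϖ ((StdForm.antidiagonal 3).over K)).Adj c w ∧ (latticeGraph σ ϖ ((StdForm.antidiagonal 3).over K)).dist ⟨stdLattice K 3, 0, isSelfDualLattice_stdLattice_three_of_v hϖ⟩ w = (latticeGraph σ ϖ ((StdForm.antidiagonal 3).over K)).dist ⟨stdLattice K 3, 0, isSelfDualLattice_stdLattice_three_of_v hϖ⟩ c + 1 ∧ latticeGraphIso σ ϖ ((StdForm.antidiagonal 3).over K) γ w = w)} ∧ (¬ w.1.map ((Matrix.toLin' (((γ : GL (Fin 3) K) : Matrix (Fin 3) (Fin 3) K) - 1)).restrictScalars 𝒪[K]) ≤ scaleLattice (ϖ ^ d₀) w.1 ∧ (w.1.map ((Matrix.toLin' (((γ : GL (Fin 3) K) : Matrix (Fin 3) (Fin 3) K) - 1)).restrictScalars 𝒪[K])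 ≤ scaleLattice (ϖ ^ (d₀ - 2)) w.1 ∧ ¬ w.1.map ((Matrix.toLin' (((γ : GL (Fin 3) K) : Matrix (Fin 3) (Fin 3) K) - 1)).restrictScalars 𝒪[K]) ≤ scaleLattice (ϖ ^ (d₀ - 1)) w.1) ∧ ∃ y ∈ w.1, ∃ a : K, Valued.v a = 1 ∧ Valued.v ((ϖ ^ (d₀ - 2))⁻¹ * pairing σ ((StdForm.antidiagonal 3).over K) y ((((γ : GL (Fin 3) K) : Matrix (Fin 3) (Fin 3) K) - 1) *ᵥ y) - (c₁) * a ^ 2) < 1)}).ncard = ({w | w ∈ {w | ∃ c, ((latticeGraph σ ϖ ((StdForm.antidiagonal 3).over K)).Adj (⟨stdLattice K 3, 0, isSelfDualLattice_stdLattice_three_of_v hϖ⟩ : {M : Submodule 𝒪[K] (Fin 3 → K) // IsVertex σ ϖ ((StdForm.antidiagonal 3).over K) M}) c ∧ (latticeGraph σ ϖ ((StdForm.antidiagonal 3).over K)).dist ⟨stdLattice K 3, 0, isSelfDualLattice_stdLattice_three_of_v hϖ⟩ c = (latticeGraph σ ϖ ((StdForm.antidiagonal 3).over K)).dist ⟨stdLattice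 K 3, 0, isSelfDualLattice_stdLattice_three_of_v hϖ⟩ (⟨stdLattice K 3, 0, isSelfDualLattice_stdLattice_three_of_v hϖ⟩ : {M : Submodule 𝒪[K] (Fin 3 → K) // IsVertex σ ϖ ((StdForm.antidiagonal 3).over K) M}) + 1 ∧ latticeGraphIso σ ϖ ((StdForm.antidiagonal 3).over K) γ c = c) ∧ ((latticeGraph σ ϖ ((StdForm.antidiagonal 3).over K)).Adj c w ∧ (latticeGraph σ ϖ ((StdForm.antidiagonal 3).over K)).dist ⟨stdLattice K 3, 0, isSelfDualLattice_stdLattice_three_of_v hϖ⟩ w = (latticeGraph σ ϖ ((StdForm.antidiagonal 3).over K)).dist ⟨stdLattice K 3, 0, isSelfDualLattice_stdLattice_three_of_v hϖ⟩ c + 1 ∧ latticeGraphIso σ ϖ ((StdForm.antidiagonal 3).over K) γ w = w)}}).ncard ∧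
      ({w | w ∈ {w | ∃ c, ((latticeGraph σ ϖ ((StdForm.antidiagonal 3).over K)).Adj (⟨stdLattice K 3, 0, isSelfDualLattice_stdLattice_three_of_v hϖ⟩ : {M : Submodule 𝒪[K] (Fin 3 → K) // IsVertex σ ϖ ((StdForm.antidiagonal 3).over K) M}) c ∧ (latticeGraph σ ϖ ((StdForm.antidiagonal 3).over K)).dist ⟨stdLattice K 3, 0, isSelfDualLattice_stdLattice_three_of_v hϖ⟩ c = (latticeGraph σ ϖ ((StdForm.antidiagonal 3).over K)).dist ⟨stdLattice K 3, 0, isSelfDualLattice_stdLattice_three_of_v hϖ⟩ (⟨stdLattice K 3, 0, isSelfDualLattice_stdLattice_three_of_v hϖ⟩ : {M : Submodule 𝒪[K] (Fin 3 → K) // IsVertex σ ϖ ((StdForm.antidiagonal 3).over K) M}) + 1 ∧ latticeGraphIso σ ϖ ((StdForm.antidiagonal 3).over K) γ c = c) ∧ ((latticeGraph σ ϖ ((StdForm.antidiagonal 3).over K)).Adj c w ∧ (latticeGraph σ ϖ ((StdForm.antidiagonal 3).over K)).dist ⟨stdLattice K 3, 0, isSelfDualLattice_stdLattice_three_of_v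 hϖ⟩ w = (latticeGraph σ ϖ ((StdForm.antidiagonal 3).over K)).dist ⟨stdLattice K 3, 0, isSelfDualLattice_stdLattice_three_of_v hϖ⟩ c + 1 ∧ latticeGraphIso σ ϖ ((StdForm.antidiagonal 3).over K) γ w = w)} ∧ (¬ w.1.map ((Matrix.toLin' (((γ : GL (Fin 3) K) : Matrix (Fin 3) (Fin 3) K) - 1)).restrictScalars 𝒪[K]) ≤ scaleLattice (ϖ ^ d₀) w.1 ∧ (w.1.map ((Matrix.toLin' (((γ : GL (Fin 3) K) : Matrix (Fin 3) (Fin 3) K) - 1)).restrictScalars 𝒪[K]) ≤ scaleLattice (ϖ ^ (d₀ - 2)) w.1 ∧ ¬ w.1.map ((Matrix.toLin' (((γ : GL (Fin 3) K) : Matrix (Fin 3) (Fin 3) K) - 1)).restrictScalars 𝒪[K]) ≤ scaleLattice (ϖ ^ (d₀ - 1)) w.1) ∧ ¬ (∃ y ∈ w.1, ∃ a : K, Valued.v a = 1 ∧ Valued.v ((ϖ ^ (d₀ - 2))⁻¹ * pairing σ ((StdForm.antidiagonal 3).over K) y ((((γ : GL (Fin 3) K) : Matrix (Fin 3) (Fin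 3) K) - 1) *ᵥ y) - (c₁) * a ^ 2) < 1))}).ncard = 0) ∧
    (¬ (∃ a : K, Valued.v a = 1 ∧ Valued.v (((γ₁ : Matrix (Fin 2) (Fin 2) K).trace - 2 * (u : Matrix (Fin 1) (Fin 1) K) 0 0) / (2 * ϖ ^ d₀) * η - c₁ * a ^ 2) < 1) →
      ({w | w ∈ {w | ∃ c, ((latticeGraph σ ϖ ((StdForm.antidiagonal 3).over K)).Adj (⟨stdLattice K 3, 0, isSelfDualLattice_stdLattice_three_of_v hϖ⟩ : {M : Submodule 𝒪[K] (Fin 3 → K) // IsVertex σ ϖ ((StdForm.antidiagonal 3).over K) M}) c ∧ (latticeGraph σ ϖ ((StdForm.antidiagonal 3).over K)).dist ⟨stdLattice K 3, 0, isSelfDualLattice_stdLattice_three_of_v hϖ⟩ c = (latticeGraph σ ϖ ((StdForm.antidiagonal 3).over K)).dist ⟨stdLattice K 3, 0, isSelfDualLattice_stdLattice_three_of_v hϖ⟩ (⟨stdLattice K 3, 0, isSelfDualLattice_stdLattice_three_of_v hϖ⟩ : {M : Submodule 𝒪[K] (Fin 3 → K) // IsVertex σ ϖ ((StdForm.antidiagonal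 3).over K) M}) + 1 ∧ latticeGraphIso σ ϖ ((StdForm.antidiagonal 3).over K) γ c = c) ∧ ((latticeGraph σ ϖ ((StdForm.antidiagonal 3).over K)).Adj c w ∧ (latticeGraph σ ϖ ((StdForm.antidiagonal 3).over K)).dist ⟨stdLattice K 3, 0, isSelfDualLattice_stdLattice_three_of_v hϖ⟩ w = (latticeGraph σ ϖ ((StdForm.antidiagonal 3).over K)).dist ⟨stdLattice K 3, 0, isSelfDualLattice_stdLattice_three_of_v hϖ⟩ c + 1 ∧ latticeGraphIso σ ϖ ((StdForm.antidiagonal 3).over K) γ w = w)} ∧ (¬ w.1.map ((Matrix.toLin' (((γ : GL (Fin 3) K) : Matrix (Fin 3) (Fin 3) K) - 1)).restrictScalars 𝒪[K]) ≤ scaleLattice (ϖ ^ d₀) w.1 ∧ (w.1.map ((Matrix.toLin' (((γ : GL (Fin 3) K) : Matrix (Fin 3) (Fin 3) K) - 1)).restrictScalars 𝒪[K]) ≤ scaleLattice (ϖ ^ (d₀ - 2)) w.1 ∧ ¬ w.1.map ((Matrix.toLin' (((γ : GL (Fin 3) K) : Matrix (Fin 3) (Fin 3) K) - 1)).restrictScalars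 𝒪[K]) ≤ scaleLattice (ϖ ^ (d₀ - 1)) w.1) ∧ ∃ y ∈ w.1, ∃ a : K, Valued.v a = 1 ∧ Valued.v ((ϖ ^ (d₀ - 2))⁻¹ * pairing σ ((StdForm.antidiagonal 3).over K) y ((((γ : GL (Fin 3) K) : Matrix (Fin 3) (Fin 3) K) - 1) *ᵥ y) - (c₁) * a ^ 2) < 1)}).ncard = 0 ∧
      ({w | w ∈ {w | ∃ c, ((latticeGraph σ ϖ ((StdForm.antidiagonal 3).over K)).Adj (⟨stdLattice K 3, 0, isSelfDualLattice_stdLattice_three_of_v hϖ⟩ : {M : Submodule 𝒪[K] (Fin 3 → K) // IsVertex σ ϖ ((StdForm.antidiagonal 3).over K) M}) c ∧ (latticeGraph σ ϖ ((StdForm.antidiagonal 3).over K)).dist ⟨stdLattice K 3, 0, isSelfDualLattice_stdLattice_three_of_v hϖ⟩ c = (latticeGraph σ ϖ ((StdForm.antidiagonal 3).over K)).dist ⟨stdLattice K 3, 0, isSelfDualLattice_stdLattice_three_of_v hϖ⟩ (⟨stdLattice K 3, 0, isSelfDualLattice_stdLattice_three_of_v hϖ⟩ : {M : Submodule 𝒪[K]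 (Fin 3 → K) // IsVertex σ ϖ ((StdForm.antidiagonal 3).over K) M}) + 1 ∧ latticeGraphIso σ ϖ ((StdForm.antidiagonal 3).over K) γ c = c) ∧ ((latticeGraph σ ϖ ((StdForm.antidiagonal 3).over K)).Adj c w ∧ (latticeGraph σ ϖ ((StdForm.antidiagonal 3).over K)).dist ⟨stdLattice K 3, 0, isSelfDualLattice_stdLattice_three_of_v hϖ⟩ w = (latticeGraph σ ϖ ((StdForm.antidiagonal 3).over K)).dist ⟨stdLattice K 3, 0, isSelfDualLattice_stdLattice_three_of_v hϖ⟩ c + 1 ∧ latticeGraphIso σ ϖ ((StdForm.antidiagonal 3).over K) γ w = w)} ∧ (¬ w.1.map ((Matrix.toLin' (((γ : GL (Fin 3) K) : Matrix (Fin 3) (Fin 3) K) - 1)).restrictScalars 𝒪[K]) ≤ scaleLattice (ϖ ^ d₀) w.1 ∧ (w.1.map ((Matrix.toLin' (((γ : GL (Fin 3) K) : Matrix (Fin 3) (Fin 3) K) - 1)).restrictScalars 𝒪[K]) ≤ scaleLattice (ϖ ^ (d₀ - 2)) w.1 ∧ ¬ w.1.map ((Matrix.toLin' (((γ : GL (Fin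 3) K) : Matrix (Fin 3) (Fin 3) K) - 1)).restrictScalars 𝒪[K]) ≤ scaleLattice (ϖ ^ (d₀ - 1)) w.1) ∧ ¬ (∃ y ∈ w.1, ∃ a : K, Valued.v a = 1 ∧ Valued.v ((ϖ ^ (d₀ - 2))⁻¹ * pairing σ ((StdForm.antidiagonal 3).over K) y ((((γ : GL (Fin 3) K) : Matrix (Fin 3) (Fin 3) K) - 1) *ᵥ y) - (c₁) * a ^ 2) < 1))}).ncard = ({w | w ∈ {w | ∃ c, ((latticeGraph σ ϖ ((StdForm.antidiagonal 3).over K)).Adj (⟨stdLattice K 3, 0, isSelfDualLattice_stdLattice_three_of_v hϖ⟩ : {M : Submodule 𝒪[K] (Fin 3 → K) // IsVertex σ ϖ ((StdForm.antidiagonal 3).over K) M}) c ∧ (latticeGraph σ ϖ ((StdForm.antidiagonal 3).over K)).dist ⟨stdLattice K 3, 0, isSelfDualLattice_stdLattice_three_of_v hϖ⟩ c = (latticeGraph σ ϖ ((StdForm.antidiagonal 3).over K)).dist ⟨stdLattice K 3, 0, isSelfDualLattice_stdLattice_three_of_v hϖ⟩ (⟨stdLattice K 3, 0, isSelfDualLattice_stdLattice_three_of_v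 hϖ⟩ : {M : Submodule 𝒪[K] (Fin 3 → K) // IsVertex σ ϖ ((StdForm.antidiagonal 3).over K) M}) + 1 ∧ latticeGraphIso σ ϖ ((StdForm.antidiagonal 3).over K) γ c = c) ∧ ((latticeGraph σ ϖ ((StdForm.antidiagonal 3).over K)).Adj c w ∧ (latticeGraph σ ϖ ((StdForm.antidiagonal 3).over K)).dist ⟨stdLattice K 3, 0, isSelfDualLattice_stdLattice_three_of_v hϖ⟩ w = (latticeGraph σ ϖ ((StdForm.antidiagonal 3).over K)).dist ⟨stdLattice K 3, 0, isSelfDualLattice_stdLattice_three_of_v hϖ⟩ c + 1 ∧ latticeGraphIso σ ϖ ((StdForm.antidiagonal 3).over K) γ w = w)}}).ncard) := by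
  -- per grandchild: the four tokens of §2 transported along `P`
  have key : ∀ x : {M : Submodule 𝒪[K] (Fin 3 → K) // IsVertex σ ϖ ((StdForm.antidiagonal 3).over K) M}, x ∈ ({w | w ∈ {w | ∃ c, ((latticeGraph σ ϖ ((StdForm.antidiagonal 3).over K)).Adj (⟨stdLattice K 3, 0, isSelfDualLattice_stdLattice_three_of_v hϖ⟩ : {M : Submodule 𝒪[K] (Fin 3 → K) // IsVertex σ ϖ ((StdForm.antidiagonal 3).over K) M}) c ∧ (latticeGraph σ ϖ ((StdForm.antidiagonal 3).over K)).dist ⟨stdLattice K 3, 0, isSelfDualLattice_stdLattice_three_of_v hϖ⟩ c = (latticeGraph σ ϖ ((StdForm.antidiagonal 3).over K)).dist ⟨stdLattice K 3, 0, isSelfDualLattice_stdLattice_three_of_v hϖ⟩ (⟨stdLattice K 3, 0, isSelfDualLattice_stdLattice_three_of_v hϖ⟩ : {M : Submodule 𝒪[K] (Fin 3 → K) // IsVertex σ ϖ ((StdForm.antidiagonal 3).over K) M}) + 1 ∧ latticeGraphIso σ ϖ ((StdForm.antidiagonal 3).over K) γ c = c) ∧ ((latticeGraph σ ϖ ((StdForm.antidiagonal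 3).over K)).Adj c w ∧ (latticeGraph σ ϖ ((StdForm.antidiagonal 3).over K)).dist ⟨stdLattice K 3, 0, isSelfDualLattice_stdLattice_three_of_v hϖ⟩ w = (latticeGraph σ ϖ ((StdForm.antidiagonal 3).over K)).dist ⟨stdLattice K 3, 0, isSelfDualLattice_stdLattice_three_of_v hϖ⟩ c + 1 ∧ latticeGraphIso σ ϖ ((StdForm.antidiagonal 3).over K) γ w = w)}}) →
      ¬ x.1.map ((Matrix.toLin' (((γ : GL (Fin 3) K) : Matrix (Fin 3) (Fin 3) K) - 1)).restrictScalars 𝒪[K]) ≤ scaleLattice (ϖ ^ d₀) x.1 ∧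
      ¬ x.1.map ((Matrix.toLin' (((γ : GL (Fin 3) K) : Matrix (Fin 3) (Fin 3) K) - 1)).restrictScalars 𝒪[K]) ≤ scaleLattice (ϖ ^ (d₀ - 1)) x.1 ∧
      x.1.map ((Matrix.toLin' (((γ : GL (Fin 3) K) : Matrix (Fin 3) (Fin 3) K) - 1)).restrictScalars 𝒪[K]) ≤ scaleLattice (ϖ ^ (d₀ - 2)) x.1 ∧
      ((∃ y ∈ x.1, ∃ a : K, Valued.v a = 1 ∧ Valued.v ((ϖ ^ (d₀ - 2))⁻¹ * pairing σ ((StdForm.antidiagonal 3).over K) y ((((γ : GL (Fin 3) K) : Matrix (Fin 3) (Fin 3) K) - 1) *ᵥ y) - (c₁) * a ^ 2) < 1) ↔ (∃ a : K, Valued.v a = 1 ∧ Valued.v (((γ₁ : Matrix (Fin 2) (Fin 2) K).trace - 2 * (u : Matrix (Fin 1) (Fin 1) K) 0 0) / (2 * ϖ ^ d₀) * η - c₁ * a ^ 2) < 1)) := by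
    intro x hx
    simp only [Set.mem_setOf_eq] at hx
    obtain ⟨c, ⟨hrc, -, -⟩, hcx, hdist, hfixx⟩ := hx
    -- self-duality and the sandwich from the `J₀`-graph
    have hrS : IsSelfDualLattice σ ϖ ((StdForm.antidiagonal 3).over K) (⟨stdLattice K 3, 0, isSelfDualLattice_stdLattice_three_of_v hϖ⟩ : {M : Submodule 𝒪[K] (Fin 3 → K) // IsVertex σ ϖ ((StdForm.antidiagonal 3).over K) M}).1 :=
      isSelfDualLattice_stdLattice_three_of_v hϖ
    have hcS : ¬ IsSelfDualLattice σ ϖ ((StdForm.antidiagonal 3).over K) c.1 := (isSelfDualLattice_iff_not_isSelfDualLattice_of_adj_of_v hvσ hϖ hrc).1 hrS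
    have hxS : IsSelfDualLattice σ ϖ ((StdForm.antidiagonal 3).over K) x.1 := by
      by_contra hxS'
      exact hcS ((isSelfDualLattice_iff_not_isSelfDualLattice_of_adj_of_v hvσ hϖ hcx).2 hxS')
    obtain ⟨hLx, hxL⟩ := scaleLattice_le_of_adj_adj_of_isSelfDualLattice hvσ hrS hxS hrc hcx
    have hxne : x.1 ≠ stdLattice K 3 := by
      intro hx1
      have hxr : x = ⟨stdLattice K 3, 0, isSelfDualLattice_stdLattice_three_of_v hϖ⟩ := Subtype.ext hx1
      rw [hxr, SimpleGraph.dist_self] at hdist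
      have hc0 : (latticeGraph σ ϖ ((StdForm.antidiagonal 3).over K)).dist ⟨stdLattice K 3, 0, isSelfDualLattice_stdLattice_three_of_v hϖ⟩ c = 0 := by omega
      rw [SimpleGraph.dist_eq_zero_iff_eq_or_not_reachable] at hc0
      rcases hc0 with hc0 | hc0
      · exact hrc.ne hc0
      · exact hc0 hrc.reachable
    -- move to the block model along `M ↦ P⁻¹·M`
    set M' : Submodule 𝒪[K] (Fin 3 → K) := mapGL P⁻¹ x.1 with hM'
    have hx1 : x.1 = mapGL P M' := by rw [hM', ← mapGL_mul, mul_inv_cancel, mapGL_one]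
    have hSD' : IsSelfDualLattice σ ϖ (!![(Matrix.diagonal d) 0 0, 0, (Matrix.diagonal d) 0 1; 0, η, 0; (Matrix.diagonal d) 1 0, 0, (Matrix.diagonal d) 1 1] : Matrix (Fin 3) (Fin 3) K) M' := by
      rw [← hP, isSelfDualLattice_formCongr_iff, ← hx1]; exact hxS
    have hP0' : mapGL P⁻¹ (stdLattice K 3) = stdLattice K 3 := by
      conv_lhs => rw [← hP0]
      rw [mapGL_inv_mapGL]
    have hLw : scaleLattice (ϖ ^ 1) (stdLattice K 3) ≤ M' := by
      rw [pow_one, ← hP0', ← mapGL_scaleLattice, hM', mapGL_le_mapGL_iff]; exact hLx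
    have hwL : scaleLattice (ϖ ^ 1) M' ≤ stdLattice K 3 := by
      rw [pow_one, ← hP0', hM', ← mapGL_scaleLattice, mapGL_le_mapGL_iff]; exact hxL
    have hne' : M' ≠ stdLattice K 3 := by
      intro h; apply hxne; rw [hx1, h, hP0]
    have hγm : ((γ : GL (Fin 3) K) : Matrix (Fin 3) (Fin 3) K) = (((P * endoGL (γ₁, u) * P⁻¹ : GL (Fin 3) K)) : Matrix (Fin 3) (Fin 3) K) := by rw [hγ]
    obtain ⟨t1, t2, t3, t4⟩ := anisotropicRoot_tokens_of_odd_regimeB σ hσ hvσ hσϖ hϖ hres h2 hd hdσ hanis₀ hanis₁ hη hησ γ₁ u hγU hD hD3 hdeep hu htr hdiscB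
      hSD' hLw hwL hne' hc₁
    refine ⟨?_, ?_, ?_, ?_⟩
    · rw [hx1, hγm, map_conj_sub_one_le_scaleLattice_iff]; exact t1
    · rw [hx1, hγm, map_conj_sub_one_le_scaleLattice_iff]; exact t2
    · rw [hx1, hγm, map_conj_sub_one_le_scaleLattice_iff]; exact t3
    · rw [hx1, hγm, exists_mem_mapGL_class_iff, hP]; exact t4
  refine ⟨?_, fun hΛ => ⟨?_, ?_⟩, fun hΛ => ⟨?_, ?_⟩⟩
  · refine Eq.trans (congrArg Set.ncard (Set.eq_empty_iff_forall_notMem.2 fun x hx => ?_)) (Set.ncard_empty _)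
    obtain ⟨hGC, -, hl1, -⟩ := hx
    exact (key x hGC).2.1 hl1
  · congr 1
    ext x
    constructor
    · exact fun h => h.1
    · intro hx
      obtain ⟨k1, k2, k3, k4⟩ := key x hx
      exact ⟨hx, k1, ⟨k3, k2⟩, k4.2 hΛ⟩
  · refine Eq.trans (congrArg Set.ncard (Set.eq_empty_iff_forall_notMem.2 fun x hx => ?_)) (Set.ncard_empty _)
    obtain ⟨hGC, -, -, hncls⟩ := hx
    exact hncls ((key x hGC).2.2.2.2 hΛ)
  · refine Eq.trans (congrArg Set.ncard (Set.eq_empty_iff_forall_notMem.2 fun x hx => ?_)) (Set.ncard_empty _)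
    obtain ⟨hGC, -, -, hcls⟩ := hx
    exact hΛ ((key x hGC).2.2.2.1 hcls)
  · congr 1
    ext x
    constructor
    · exact fun h => h.1
    · intro hx
      obtain ⟨k1, k2, k3, k4⟩ := key x hx
      exact ⟨hx, k1, ⟨k3, k2⟩, fun hcls => hΛ (k4.1 hcls)⟩

/-! ## §4 The chair's orientation `Λ(c)`: for a residual NON-SQUARE `η` the anisotropic root chains lie in `CLS(c)` iff `¬Λ(c)` -/

/-- **TWO SQUARE CLASSES**: for units `X, c` and a unit `η` that is a residual NON-SQUARE (`|z² − η| = 1` for all integral `z`), «`X·η ≡ c·a²` for some unit `a`» iff NOT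
«`X ≡ c·a²` for some unit `a`» (`χ(X̄η̄∕c̄) = −χ(X̄∕c̄)`, `χ` the quadratic character of the finite residue field). [cite: IrelandRosen1990, Ch. 8 §1] [cite: Rogawski1990, §4.9 p. 55] -/
theorem exists_unit_v_mul_sub_mul_sq_lt_one_iff_not [Fintype 𝓀[K]] [DecidableEq 𝓀[K]]
    {X η c : K} (hX : Valued.v X = 1) (hη : Valued.v η = 1) (hc : Valued.v c = 1)
    (hηN : ∀ z : K, Valued.v z ≤ 1 → Valued.v (z ^ 2 - η) = 1) :
    (∃ a : K, Valued.v a = 1 ∧ Valued.v (X * η - c * a ^ 2) < 1) ↔ ¬ ∃ a : K, Valued.v a = 1 ∧ Valued.v (X - c * a ^ 2) < 1 := by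
  set Xo : 𝒪[K] := ⟨X, (Valuation.mem_integer_iff _ _).2 hX.le⟩ with hXo
  set ηo : 𝒪[K] := ⟨η, (Valuation.mem_integer_iff _ _).2 hη.le⟩ with hηo
  set co : 𝒪[K] := ⟨c, (Valuation.mem_integer_iff _ _).2 hc.le⟩ with hco
  have hc0 : IsLocalRing.residue 𝒪[K] co ≠ 0 := residue_ne_zero_of_v_eq_one co hc
  have hX0 : IsLocalRing.residue 𝒪[K] Xo ≠ 0 := residue_ne_zero_of_v_eq_one Xo hX
  -- `η̄` is a non-square
  have hηχ : quadraticChar 𝓀[K] (IsLocalRing.residue 𝒪[K] ηo) = -1 := by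
    rw [quadraticChar_neg_one_iff_not_isSquare]
    rintro ⟨r, hr⟩
    obtain ⟨z, rfl⟩ := IsLocalRing.residue_surjective r
    have h0 : IsLocalRing.residue 𝒪[K] (z ^ 2 - ηo) = 0 := by rw [map_sub, map_pow, hr, sq, sub_self]
    rw [residue_eq_zero_iff_v_lt_one] at h0
    have h1 := hηN (z : K) z.2
    push_cast at h0
    rw [h1] at h0
    exact lt_irrefl _ h0
  have e1 : (∃ a : K, Valued.v a = 1 ∧ Valued.v (X * η - c * a ^ 2) < 1) ↔ quadraticChar 𝓀[K] ((IsLocalRing.residue 𝒪[K] co)⁻¹ * IsLocalRing.residue 𝒪[K] (Xo * ηo)) = 1 := by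
    have h := exists_unit_v_sub_mul_sq_lt_one_iff_residue (Xo * ηo) co
    push_cast at h
    rw [h, Literature.NumberTheory.Rogawski1990.exists_ne_zero_eq_mul_sq_iff_quadraticChar hc0]
  have e2 : (∃ a : K, Valued.v a = 1 ∧ Valued.v (X - c * a ^ 2) < 1) ↔ quadraticChar 𝓀[K] ((IsLocalRing.residue 𝒪[K] co)⁻¹ * IsLocalRing.residue 𝒪[K] Xo) = 1 := by
    have h := exists_unit_v_sub_mul_sq_lt_one_iff_residue Xo co
    rw [h, Literature.NumberTheory.Rogawski1990.exists_ne_zero_eq_mul_sq_iff_quadraticChar hc0]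
  have hy0 : (IsLocalRing.residue 𝒪[K] co)⁻¹ * IsLocalRing.residue 𝒪[K] Xo ≠ 0 := mul_ne_zero (inv_ne_zero hc0) hX0
  rw [e1, e2, map_mul (IsLocalRing.residue 𝒪[K]) Xo ηo, ← mul_assoc]
  set y : 𝓀[K] := (IsLocalRing.residue 𝒪[K] co)⁻¹ * IsLocalRing.residue 𝒪[K] Xo with hy
  rw [map_mul (quadraticChar 𝓀[K]) y, hηχ, mul_neg, mul_one, neg_eq_iff_eq_neg]
  exact quadraticChar_eq_neg_one_iff_not_one hy0

set_option maxHeartbeats 1600000 in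
-- budget only: statement-heavy lattice tokens (the ★ odd head's set-builders verbatim).
/-- **(§4) THE REGIME-B ANISOTROPIC ROOT CENSUS, ORIENTED BY THE CHAIR'S `Λ(c₁)`** ((Cnt2′) RULING (15): `Λ(c) := ∃ a, |a| = 1 ∧ |(tr γ₁ − 2u₀₀)∕(2ϖ^{d₀}) − c·a²| < 1`, «the
scalar root datum `b` lies in the class of `c`»).  Under the hypotheses of §3 and **`η` a residual NON-SQUARE** (`hηN`, the shape of the ★ head's `hε`; automatic for the frame of the
anisotropic `Φ₃`-literal since `d̄₀d̄₁η̄ ≡ −1` and `−d̄₀d̄₁` is a non-square): `#E = 0`, **`Λ(c₁) → #P(c₁) = 0 ∧ #M(c₁) = #GC(r₀)`**, **`¬Λ(c₁) → #P(c₁) = #GC(r₀) ∧ #M(c₁) = 0`** —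
«aniso root chains ∈ CLS(c) ⟺ ¬Λ(c)» (all `(q+1)q` of them; `#GC(r₀) = (q+1)q` by ★ p849286 §5). [cite: Kottwitz1986, §3] [cite: LabesseLanglands1979, §2]
[cite: Rogawski1990, §4.9 Prop. 4.9.1 (b) p. 55, Lemma 4.9.3 p. 56] [cite: IrelandRosen1990, Ch. 8 §1] -/
theorem anisotropicRoot_odd_census_of_coe_eq_conj_endoGL_of_nonsquare [IsPrincipalIdealRing 𝒪[K]] [Fintype 𝓀[K]] [DecidableEq 𝓀[K]]
    (hσ : ∀ a, σ (σ a) = a) (hvσ : ∀ a, Valued.v (σ a) = Valued.v a) (hσϖ : σ ϖ = -ϖ) (hϖ : Valued.v ϖ = WithZero.exp (-1 : ℤ))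
    (hres : ∀ x : K, Valued.v x ≤ 1 → Valued.v (σ x - x) < 1) (h2 : Valued.v (2 : K) = 1)
    {d : Fin 2 → K} {η : K} (P : GL (Fin 3) K)
    (hP : formCongr σ P ((StdForm.antidiagonal 3).over K) = (!![(Matrix.diagonal d) 0 0, 0, (Matrix.diagonal d) 0 1; 0, η, 0; (Matrix.diagonal d) 1 0, 0, (Matrix.diagonal d) 1 1] : Matrix (Fin 3) (Fin 3) K))
    (hP0 : mapGL P (stdLattice K 3) = stdLattice K 3)
    (hd : ∀ i, Valued.v (d i) = 1) (hdσ : ∀ i, σ (d i) = d i)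
    (hanis₀ : ∀ c : K, Valued.v c ≤ 1 → Valued.v (d 0 + d 1 * (σ c * c)) = 1)
    (hanis₁ : ∀ c : K, Valued.v c ≤ 1 → Valued.v (d 0 * (σ c * c) + d 1) = 1)
    (hησ : σ η = η) (hη : Valued.v η = 1) (hηN : ∀ z : K, Valued.v z ≤ 1 → Valued.v (z ^ 2 - η) = 1)
    (γ : unitaryGroupOfForm σ ((StdForm.antidiagonal 3).over K))
    (γ₁ : GL (Fin 2) K) (u : GL (Fin 1) K) (hγ : (γ : GL (Fin 3) K) = P * endoGL (γ₁, u) * P⁻¹)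
    (hγU : γ₁ ∈ unitaryGroupOfForm σ (Matrix.diagonal d))
    {d₀ : ℕ} (hD : Odd d₀) (hD3 : 3 ≤ d₀)
    (hdeep : ∀ i j, Valued.v (((γ₁ : Matrix (Fin 2) (Fin 2) K) - 1) i j) ≤ Valued.v ϖ ^ d₀)
    (hu : Valued.v ((u : Matrix (Fin 1) (Fin 1) K) 0 0 - 1) < Valued.v ϖ ^ d₀)
    (htr : Valued.v ((γ₁ : Matrix (Fin 2) (Fin 2) K).trace - 2 * (u : Matrix (Fin 1) (Fin 1) K) 0 0) = Valued.v ϖ ^ d₀)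
    (hdiscB : Valued.v ((γ₁ : Matrix (Fin 2) (Fin 2) K).trace ^ 2 - 4 * (γ₁ : Matrix (Fin 2) (Fin 2) K).det) < Valued.v ϖ ^ (2 * d₀)) (c₁ : K) (hc₁ : Valued.v c₁ = 1) :
    ({w | w ∈ {w | ∃ c, ((latticeGraph σ ϖ ((StdForm.antidiagonal 3).over K)).Adj (⟨stdLattice K 3, 0, isSelfDualLattice_stdLattice_three_of_v hϖ⟩ : {M : Submodule 𝒪[K] (Fin 3 → K) // IsVertex σ ϖ ((StdForm.antidiagonal 3).over K) M}) c ∧ (latticeGraph σ ϖ ((StdForm.antidiagonal 3).over K)).dist ⟨stdLattice K 3, 0, isSelfDualLattice_stdLattice_three_of_v hϖ⟩ c = (latticeGraph σ ϖ ((StdForm.antidiagonal 3).over K)).dist ⟨stdLattice K 3, 0, isSelfDualLattice_stdLattice_three_of_v hϖ⟩ (⟨stdLattice K 3, 0, isSelfDualLattice_stdLattice_three_of_v hϖ⟩ : {M : Submodule 𝒪[K] (Fin 3 → K) // IsVertex σ ϖ ((StdForm.antidiagonal 3).over K) M}) + 1 ∧ latticeGraphIso σ ϖ ((StdForm.antidiagonal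 3).over K) γ c = c) ∧ ((latticeGraph σ ϖ ((StdForm.antidiagonal 3).over K)).Adj c w ∧ (latticeGraph σ ϖ ((StdForm.antidiagonal 3).over K)).dist ⟨stdLattice K 3, 0, isSelfDualLattice_stdLattice_three_of_v hϖ⟩ w = (latticeGraph σ ϖ ((StdForm.antidiagonal 3).over K)).dist ⟨stdLattice K 3, 0, isSelfDualLattice_stdLattice_three_of_v hϖ⟩ c + 1 ∧ latticeGraphIso σ ϖ ((StdForm.antidiagonal 3).over K) γ w = w)} ∧ (¬ w.1.map ((Matrix.toLin' (((γ : GL (Fin 3) K) : Matrix (Fin 3) (Fin 3) K) - 1)).restrictScalars 𝒪[K]) ≤ scaleLattice (ϖ ^ d₀) w.1 ∧ (w.1.map ((Matrix.toLin' (((γ : GL (Fin 3) K) : Matrix (Fin 3) (Fin 3) K) - 1)).restrictScalars 𝒪[K]) ≤ scaleLattice (ϖ ^ (d₀ - 1)) w.1 ∧ ¬ w.1.map ((Matrix.toLin' (((γ : GL (Fin 3) K) : Matrix (Fin 3) (Fin 3) K) - 1)).restrictScalars 𝒪[K]) ≤ scaleLattice (ϖ ^ d₀) w.1))}).ncard =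 0 ∧
    ((∃ a : K, Valued.v a = 1 ∧ Valued.v (((γ₁ : Matrix (Fin 2) (Fin 2) K).trace - 2 * (u : Matrix (Fin 1) (Fin 1) K) 0 0) / (2 * ϖ ^ d₀) - c₁ * a ^ 2) < 1) →
      ({w | w ∈ {w | ∃ c, ((latticeGraph σ ϖ ((StdForm.antidiagonal 3).over K)).Adj (⟨stdLattice K 3, 0, isSelfDualLattice_stdLattice_three_of_v hϖ⟩ : {M : Submodule 𝒪[K] (Fin 3 → K) // IsVertex σ ϖ ((StdForm.antidiagonal 3).over K) M}) c ∧ (latticeGraph σ ϖ ((StdForm.antidiagonal 3).over K)).dist ⟨stdLattice K 3, 0, isSelfDualLattice_stdLattice_three_of_v hϖ⟩ c = (latticeGraph σ ϖ ((StdForm.antidiagonal 3).over K)).dist ⟨stdLattice K 3, 0, isSelfDualLattice_stdLattice_three_of_v hϖ⟩ (⟨stdLattice K 3, 0, isSelfDualLattice_stdLattice_three_of_v hϖ⟩ : {M : Submodule 𝒪[K] (Fin 3 → K) // IsVertex σ ϖ ((StdForm.antidiagonal 3).over K) M}) + 1 ∧ latticeGraphIso σ ϖ ((StdForm.antidiagonal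 3).over K) γ c = c) ∧ ((latticeGraph σ ϖ ((StdForm.antidiagonal 3).over K)).Adj c w ∧ (latticeGraph σ ϖ ((StdForm.antidiagonal 3).over K)).dist ⟨stdLattice K 3, 0, isSelfDualLattice_stdLattice_three_of_v hϖ⟩ w = (latticeGraph σ ϖ ((StdForm.antidiagonal 3).over K)).dist ⟨stdLattice K 3, 0, isSelfDualLattice_stdLattice_three_of_v hϖ⟩ c + 1 ∧ latticeGraphIso σ ϖ ((StdForm.antidiagonal 3).over K) γ w = w)} ∧ (¬ w.1.map ((Matrix.toLin' (((γ : GL (Fin 3) K) : Matrix (Fin 3) (Fin 3) K) - 1)).restrictScalars 𝒪[K]) ≤ scaleLattice (ϖ ^ d₀) w.1 ∧ (w.1.map ((Matrix.toLin' (((γ : GL (Fin 3) K) : Matrix (Fin 3) (Fin 3) K) - 1)).restrictScalars 𝒪[K]) ≤ scaleLattice (ϖ ^ (d₀ - 2)) w.1 ∧ ¬ w.1.map ((Matrix.toLin' (((γ : GL (Fin 3) K) : Matrix (Fin 3) (Fin 3) K) - 1)).restrictScalars 𝒪[K]) ≤ scaleLattice (ϖ ^ (d₀ - 1)) w.1)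 ∧ ∃ y ∈ w.1, ∃ a : K, Valued.v a = 1 ∧ Valued.v ((ϖ ^ (d₀ - 2))⁻¹ * pairing σ ((StdForm.antidiagonal 3).over K) y ((((γ : GL (Fin 3) K) : Matrix (Fin 3) (Fin 3) K) - 1) *ᵥ y) - (c₁) * a ^ 2) < 1)}).ncard = 0 ∧
      ({w | w ∈ {w | ∃ c, ((latticeGraph σ ϖ ((StdForm.antidiagonal 3).over K)).Adj (⟨stdLattice K 3, 0, isSelfDualLattice_stdLattice_three_of_v hϖ⟩ : {M : Submodule 𝒪[K] (Fin 3 → K) // IsVertex σ ϖ ((StdForm.antidiagonal 3).over K) M}) c ∧ (latticeGraph σ ϖ ((StdForm.antidiagonal 3).over K)).dist ⟨stdLattice K 3, 0, isSelfDualLattice_stdLattice_three_of_v hϖ⟩ c = (latticeGraph σ ϖ ((StdForm.antidiagonal 3).over K)).dist ⟨stdLattice K 3, 0, isSelfDualLattice_stdLattice_three_of_v hϖ⟩ (⟨stdLattice K 3, 0, isSelfDualLattice_stdLattice_three_of_v hϖ⟩ : {M : Submodule 𝒪[K] (Fin 3 → K) // IsVertex σ ϖ ((StdForm.antidiagonal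 3).over K) M}) + 1 ∧ latticeGraphIso σ ϖ ((StdForm.antidiagonal 3).over K) γ c = c) ∧ ((latticeGraph σ ϖ ((StdForm.antidiagonal 3).over K)).Adj c w ∧ (latticeGraph σ ϖ ((StdForm.antidiagonal 3).over K)).dist ⟨stdLattice K 3, 0, isSelfDualLattice_stdLattice_three_of_v hϖ⟩ w = (latticeGraph σ ϖ ((StdForm.antidiagonal 3).over K)).dist ⟨stdLattice K 3, 0, isSelfDualLattice_stdLattice_three_of_v hϖ⟩ c + 1 ∧ latticeGraphIso σ ϖ ((StdForm.antidiagonal 3).over K) γ w = w)} ∧ (¬ w.1.map ((Matrix.toLin' (((γ : GL (Fin 3) K) : Matrix (Fin 3) (Fin 3) K) - 1)).restrictScalars 𝒪[K]) ≤ scaleLattice (ϖ ^ d₀) w.1 ∧ (w.1.map ((Matrix.toLin' (((γ : GL (Fin 3) K) : Matrix (Fin 3) (Fin 3) K) - 1)).restrictScalars 𝒪[K]) ≤ scaleLattice (ϖ ^ (d₀ - 2)) w.1 ∧ ¬ w.1.map ((Matrix.toLin' (((γ : GL (Fin 3) K) : Matrix (Fin 3) (Fin 3) K) - 1)).restrictScalars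 𝒪[K]) ≤ scaleLattice (ϖ ^ (d₀ - 1)) w.1) ∧ ¬ (∃ y ∈ w.1, ∃ a : K, Valued.v a = 1 ∧ Valued.v ((ϖ ^ (d₀ - 2))⁻¹ * pairing σ ((StdForm.antidiagonal 3).over K) y ((((γ : GL (Fin 3) K) : Matrix (Fin 3) (Fin 3) K) - 1) *ᵥ y) - (c₁) * a ^ 2) < 1))}).ncard = ({w | w ∈ {w | ∃ c, ((latticeGraph σ ϖ ((StdForm.antidiagonal 3).over K)).Adj (⟨stdLattice K 3, 0, isSelfDualLattice_stdLattice_three_of_v hϖ⟩ : {M : Submodule 𝒪[K] (Fin 3 → K) // IsVertex σ ϖ ((StdForm.antidiagonal 3).over K) M}) c ∧ (latticeGraph σ ϖ ((StdForm.antidiagonal 3).over K)).dist ⟨stdLattice K 3, 0, isSelfDualLattice_stdLattice_three_of_v hϖ⟩ c = (latticeGraph σ ϖ ((StdForm.antidiagonal 3).over K)).dist ⟨stdLattice K 3, 0, isSelfDualLattice_stdLattice_three_of_v hϖ⟩ (⟨stdLattice K 3, 0, isSelfDualLattice_stdLattice_three_of_v hϖ⟩ : {M : Submodule 𝒪[K]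 (Fin 3 → K) // IsVertex σ ϖ ((StdForm.antidiagonal 3).over K) M}) + 1 ∧ latticeGraphIso σ ϖ ((StdForm.antidiagonal 3).over K) γ c = c) ∧ ((latticeGraph σ ϖ ((StdForm.antidiagonal 3).over K)).Adj c w ∧ (latticeGraph σ ϖ ((StdForm.antidiagonal 3).over K)).dist ⟨stdLattice K 3, 0, isSelfDualLattice_stdLattice_three_of_v hϖ⟩ w = (latticeGraph σ ϖ ((StdForm.antidiagonal 3).over K)).dist ⟨stdLattice K 3, 0, isSelfDualLattice_stdLattice_three_of_v hϖ⟩ c + 1 ∧ latticeGraphIso σ ϖ ((StdForm.antidiagonal 3).over K) γ w = w)}}).ncard) ∧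
    (¬ (∃ a : K, Valued.v a = 1 ∧ Valued.v (((γ₁ : Matrix (Fin 2) (Fin 2) K).trace - 2 * (u : Matrix (Fin 1) (Fin 1) K) 0 0) / (2 * ϖ ^ d₀) - c₁ * a ^ 2) < 1) →
      ({w | w ∈ {w | ∃ c, ((latticeGraph σ ϖ ((StdForm.antidiagonal 3).over K)).Adj (⟨stdLattice K 3, 0, isSelfDualLattice_stdLattice_three_of_v hϖ⟩ : {M : Submodule 𝒪[K] (Fin 3 → K) // IsVertex σ ϖ ((StdForm.antidiagonal 3).over K) M}) c ∧ (latticeGraph σ ϖ ((StdForm.antidiagonal 3).over K)).dist ⟨stdLattice K 3, 0, isSelfDualLattice_stdLattice_three_of_v hϖ⟩ c = (latticeGraph σ ϖ ((StdForm.antidiagonal 3).over K)).dist ⟨stdLattice K 3, 0, isSelfDualLattice_stdLattice_three_of_v hϖ⟩ (⟨stdLattice K 3, 0, isSelfDualLattice_stdLattice_three_of_v hϖ⟩ : {M : Submodule 𝒪[K] (Fin 3 → K) // IsVertex σ ϖ ((StdForm.antidiagonal 3).over K) M}) + 1 ∧ latticeGraphIso σ ϖ ((StdForm.antidiagonal 3).over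 K) γ c = c) ∧ ((latticeGraph σ ϖ ((StdForm.antidiagonal 3).over K)).Adj c w ∧ (latticeGraph σ ϖ ((StdForm.antidiagonal 3).over K)).dist ⟨stdLattice K 3, 0, isSelfDualLattice_stdLattice_three_of_v hϖ⟩ w = (latticeGraph σ ϖ ((StdForm.antidiagonal 3).over K)).dist ⟨stdLattice K 3, 0, isSelfDualLattice_stdLattice_three_of_v hϖ⟩ c + 1 ∧ latticeGraphIso σ ϖ ((StdForm.antidiagonal 3).over K) γ w = w)} ∧ (¬ w.1.map ((Matrix.toLin' (((γ : GL (Fin 3) K) : Matrix (Fin 3) (Fin 3) K) - 1)).restrictScalars 𝒪[K]) ≤ scaleLattice (ϖ ^ d₀) w.1 ∧ (w.1.map ((Matrix.toLin' (((γ : GL (Fin 3) K) : Matrix (Fin 3) (Fin 3) K) - 1)).restrictScalars 𝒪[K]) ≤ scaleLattice (ϖ ^ (d₀ - 2)) w.1 ∧ ¬ w.1.map ((Matrix.toLin' (((γ : GL (Fin 3) K) : Matrix (Fin 3) (Fin 3) K) - 1)).restrictScalars 𝒪[K]) ≤ scaleLattice (ϖ ^ (d₀ - 1)) w.1) ∧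 ∃ y ∈ w.1, ∃ a : K, Valued.v a = 1 ∧ Valued.v ((ϖ ^ (d₀ - 2))⁻¹ * pairing σ ((StdForm.antidiagonal 3).over K) y ((((γ : GL (Fin 3) K) : Matrix (Fin 3) (Fin 3) K) - 1) *ᵥ y) - (c₁) * a ^ 2) < 1)}).ncard = ({w | w ∈ {w | ∃ c, ((latticeGraph σ ϖ ((StdForm.antidiagonal 3).over K)).Adj (⟨stdLattice K 3, 0, isSelfDualLattice_stdLattice_three_of_v hϖ⟩ : {M : Submodule 𝒪[K] (Fin 3 → K) // IsVertex σ ϖ ((StdForm.antidiagonal 3).over K) M}) c ∧ (latticeGraph σ ϖ ((StdForm.antidiagonal 3).over K)).dist ⟨stdLattice K 3, 0, isSelfDualLattice_stdLattice_three_of_v hϖ⟩ c = (latticeGraph σ ϖ ((StdForm.antidiagonal 3).over K)).dist ⟨stdLattice K 3, 0, isSelfDualLattice_stdLattice_three_of_v hϖ⟩ (⟨stdLattice K 3, 0, isSelfDualLattice_stdLattice_three_of_v hϖ⟩ : {M : Submodule 𝒪[K] (Fin 3 → K) // IsVertex σ ϖ ((StdForm.antidiagonal 3).over K) M}) + 1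 ∧ latticeGraphIso σ ϖ ((StdForm.antidiagonal 3).over K) γ c = c) ∧ ((latticeGraph σ ϖ ((StdForm.antidiagonal 3).over K)).Adj c w ∧ (latticeGraph σ ϖ ((StdForm.antidiagonal 3).over K)).dist ⟨stdLattice K 3, 0, isSelfDualLattice_stdLattice_three_of_v hϖ⟩ w = (latticeGraph σ ϖ ((StdForm.antidiagonal 3).over K)).dist ⟨stdLattice K 3, 0, isSelfDualLattice_stdLattice_three_of_v hϖ⟩ c + 1 ∧ latticeGraphIso σ ϖ ((StdForm.antidiagonal 3).over K) γ w = w)}}).ncard ∧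
      ({w | w ∈ {w | ∃ c, ((latticeGraph σ ϖ ((StdForm.antidiagonal 3).over K)).Adj (⟨stdLattice K 3, 0, isSelfDualLattice_stdLattice_three_of_v hϖ⟩ : {M : Submodule 𝒪[K] (Fin 3 → K) // IsVertex σ ϖ ((StdForm.antidiagonal 3).over K) M}) c ∧ (latticeGraph σ ϖ ((StdForm.antidiagonal 3).over K)).dist ⟨stdLattice K 3, 0, isSelfDualLattice_stdLattice_three_of_v hϖ⟩ c = (latticeGraph σ ϖ ((StdForm.antidiagonal 3).over K)).dist ⟨stdLattice K 3, 0, isSelfDualLattice_stdLattice_three_of_v hϖ⟩ (⟨stdLattice K 3, 0, isSelfDualLattice_stdLattice_three_of_v hϖ⟩ : {M : Submodule 𝒪[K] (Fin 3 → K) // IsVertex σ ϖ ((StdForm.antidiagonal 3).over K) M}) + 1 ∧ latticeGraphIso σ ϖ ((StdForm.antidiagonal 3).over K) γ c = c) ∧ ((latticeGraph σ ϖ ((StdForm.antidiagonal 3).over K)).Adj c w ∧ (latticeGraph σ ϖ ((StdForm.antidiagonal 3).over K)).dist ⟨stdLattice K 3, 0, isSelfDualLattice_stdLattice_three_of_v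 hϖ⟩ w = (latticeGraph σ ϖ ((StdForm.antidiagonal 3).over K)).dist ⟨stdLattice K 3, 0, isSelfDualLattice_stdLattice_three_of_v hϖ⟩ c + 1 ∧ latticeGraphIso σ ϖ ((StdForm.antidiagonal 3).over K) γ w = w)} ∧ (¬ w.1.map ((Matrix.toLin' (((γ : GL (Fin 3) K) : Matrix (Fin 3) (Fin 3) K) - 1)).restrictScalars 𝒪[K]) ≤ scaleLattice (ϖ ^ d₀) w.1 ∧ (w.1.map ((Matrix.toLin' (((γ : GL (Fin 3) K) : Matrix (Fin 3) (Fin 3) K) - 1)).restrictScalars 𝒪[K]) ≤ scaleLattice (ϖ ^ (d₀ - 2)) w.1 ∧ ¬ w.1.map ((Matrix.toLin' (((γ : GL (Fin 3) K) : Matrix (Fin 3) (Fin 3) K) - 1)).restrictScalars 𝒪[K]) ≤ scaleLattice (ϖ ^ (d₀ - 1)) w.1) ∧ ¬ (∃ y ∈ w.1, ∃ a : K, Valued.v a = 1 ∧ Valued.v ((ϖ ^ (d₀ - 2))⁻¹ * pairing σ ((StdForm.antidiagonal 3).over K) y ((((γ : GL (Fin 3) K) : Matrix (Fin 3) (Fin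 3) K) - 1) *ᵥ y) - (c₁) * a ^ 2) < 1))}).ncard = 0) := by
  obtain ⟨hE, hpos, hneg⟩ := anisotropicRoot_odd_census_of_coe_eq_conj_endoGL hσ hvσ hσϖ hϖ hres h2 P hP hP0 hd hdσ hanis₀ hanis₁ hησ hη γ γ₁ u hγ hγU
    hD hD3 hdeep hu htr hdiscB c₁ hc₁
  have hϖ0 : ϖ ≠ 0 := fun h0 => by rw [h0, map_zero] at hϖ; exact WithZero.coe_ne_zero hϖ.symm
  have hpow : 0 < Valued.v ϖ ^ d₀ := by rw [← map_pow]; exact zero_lt_iff.2 ((Valuation.ne_zero_iff _).2 (pow_ne_zero _ hϖ0))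
  have hb : Valued.v (((γ₁ : Matrix (Fin 2) (Fin 2) K).trace - 2 * (u : Matrix (Fin 1) (Fin 1) K) 0 0) / (2 * ϖ ^ d₀)) = 1 := by
    rw [map_div₀, htr, map_mul, h2, one_mul, map_pow, div_self hpow.ne']
  have hiff := exists_unit_v_mul_sub_mul_sq_lt_one_iff_not hb hη hc₁ hηN
  exact ⟨hE, fun hΛ => hneg (fun hΛη => hiff.1 hΛη hΛ), fun hΛ => hpos (hiff.2 hΛ)⟩

end Literature.NumberTheory.Automorphic.UnitaryLatticeTree

end
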